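import Literature.NumberTheory.LFunctions.ExceptionalZeroLOneWidth
import Literature.NumberTheory.LFunctions.ExceptionalPrimesHyperbola
import Literature.NumberTheory.LFunctions.DirichletLOneTail
import Literature.NumberTheory.LFunctions.SiegelTheorem
import Literature.NumberTheory.LFunctions.SiegelZeroExceptionalPrimesSecond
import Mathlib.Analysis.SumIntegralComparisons
import HarnessLib

/-!
# Friedlander–Iwaniec 2018, Proposition 2.1 and (3.7) — PROVED; (4.1) and Theorem 2 unconditional

Topic `Literature/NumberTheory/LFunctions` (namespace `Literature.NumberTheory.LFunctions`; helper
lemmas in `FI2018`). PROOF LAYER for the statement file `ExceptionalZeroLOneWidth.lean` (cell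
`landau-siegel`, rung F-S3, §C harvest row T-077): the named fact

* `fi2018_proposition21` — J. B. Friedlander, H. Iwaniec, *A note on Dirichlet `L`-functions*,
  Expo. Math. 36 (2018) 343–350 = arXiv:1701.03771, §2 Proposition 2.1 (2.2): for a real primitive
  `χ` of conductor `D` (large) with a real zero `β`, `1 − β ≤ (3 log D)^{−1}`,
  `L(1,χ) ≍ (1 − β) S(D)`, `S(x) = Σ_{n ≤ x} λ(n)(1 − n/x) n^{−β}`, `λ = 1 ∗ χ`

is discharged here as `theorem fi2018_proposition21_holds : fi2018_proposition21` (with the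
absolute constants `c₁ = 1/2`, `c₂ = 8/3`), and so is the Deuring–Heilbronn step

* `fi2018_eq37` — loc. cit. §3 (3.7): `S(D) ≪ (log η)^{−1} (log D)²`, `η = 1/((1 − β) log D) ≥ 3`

as `theorem fi2018_eq37_holds : fi2018_eq37` (§6 below). Consequently the statement file's
`FI2018.eq41_of` ((4.1)) and `FI2018.theorem2_of` (Theorem 2 of the note) become UNCONDITIONAL:
`FI2018.eq41` and `FI2018.theorem2` (§7). Only the conditional Theorem 3 (`fi2018_theorem3`)
remains a named fact of that file.

## The printed proof and the road taken here (declared deviations)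

PRINT (p0003): "`S(x) = (1/2πi) ∫_{(1)} Z(s+β) x^s ds/(s(s+1)) = L(1,χ) x^{1−β}/((1−β)(2−β))
+ O(x^{−1} D^{1/2} log D)`" (`Z = ζ · L(·,χ)`; contour shift, the pole of `1/s` at `s = 0` being
cancelled by `Z(β) = 0`), "Hence `L(1,χ) ≍ (1−β) S(D)`."

HERE (the tree has no Perron formula / vertical growth kit for `ζ(s)L(s,χ)`, but a complete
ELEMENTARY kit for `Σ (1∗χ)(n) n^{−β}` — `ExceptionalPrimesHyperbola.lean`,
`ExceptionalPrimesPowerSums.lean`, `ExceptionalPrimesAbel.lean`, `DirichletLOneTail.lean`):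

1. Dirichlet's hyperbola rearrangement `S(D) = Σ_{d ≤ D} χ(d) d^{−β} G_d`,
   `G_d = Σ_{m ≤ D/d} m^{−β}(1 − dm/D)` (`FI2018.smoothSum_natCast_eq`).
2. `G_d = y^{1−β}/((1−β)(2−β)) + C + R_d` with `y = D/d`, the constant
   `C = Σ_{m ≤ D} m^{−β} − D^{1−β}/(1−β)` (`|C| ≤ 1/(1−β)`), and `|R_d| ≤ 7/((1−β) y)`
   (`FI2018.riesz_powerSum_estimate`, `FI2018.riesz_term_estimate`) — from the tree's secant
   bounds for power sums (`SiegelZero.sum_Ioc_rpow_bounds`, `SiegelZero.rpow_sub_floor_rpow_bounds`,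
   `SiegelZero.abs_sum_Icc_rpow_sub_le`), a discrete Abel summation for `Σ m · m^{−β}`, and the
   comparison of `Σ_{k<N} k^{1−β}` with `∫ t^{1−β} dt` (Mathlib's `MonotoneOn.sum_le_integral`).
3. Tails `Σ_{d ≤ D} χ(d)/d = L(1,χ) + O(B/D)` and — at the ZERO `β` — `Σ_{d ≤ D} χ(d) d^{−β} =
   O(B D^{−β})`, with the PÓLYA–VINOGRADOV bound `B = √D (1 + log D)` for the partial sums of `χ`
   (`DirichletAbel.norm_partialSum_le_polyaVinogradov`); the range `d > D^{7/8}` of the error sum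
   by finite Abel summation against the non-increasing weight `d ↦ d^{−β} G_d`, the range
   `d ≤ D^{7/8}` trivially. Result (`FI2018.abs_smoothSum_sub_main_le`):
   `|S(D) − L(1,χ) D^{1−β}/((1−β)(2−β))| ≤ 24 (1 + log D) D^{−1/8}/(1 − β)`.
4. The "Hence" of print (error `≪` main term `≥ (3/4) L(1,χ)/(1−β)`) is made explicit by SIEGEL's
   theorem with `ε = 1/16` (the tree's `Siegel.siegel_theorem_primitive`, Montgomery–Vaughan
   Thm. 11.14): `L(1,χ) ≥ c D^{−1/16}` beats `(1 + log D) D^{−1/8}` for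
   `D ≥ D₀ = max(3, ⌈(2112/c)^{32}⌉)`. Hence `D₀` is INEFFECTIVE here; the typed statement is
   `∃ c₁ c₂ D₀` and print does not discuss this step (for the EXCEPTIONAL zero of MV Thm. 11.3 the
   effective `1 − β ≪ L(1,χ)`, the tree's `MontgomeryVaughan2007_thm11_4_LOne_exceptional_holds`,
   would do; the typed hypothesis `FI2018.IsCloseRealZero` does not assert that `β` is that zero,
   and the main term `≥ (3/4) L(1,χ)/(1−β)` may then be as small as `≍ D^{−1/2} log D`).

For (3.7) (§6): the printed split `∏_{p ≤ B} · ∏_{B < p ≤ D}` at `log B = (log η)^{−1/2} log D`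
is followed, with (3.1) in the exact form `Σ_{n ≤ D} λ(n)/n ≤ ∏_{p ≤ D}(1 − 1/p)^{−1}(1 − χ(p)/p)^{−1}`
(`SmoothEulerProduct.sum_le_smoothProduct`), (3.2) from Mertens
(`MertensBound.exp_neg_div_log_le_prod_one_sub_inv`), and — declared deviation — Heath-Brown's
Lemma 3 ((3.6), the input for the range `B < p ≤ D`) replaced by Tao–Teräväinen's Corollary 3.6
(first bound), a THEOREM of the tree (`SiegelZero.TaoTeravainen2021_cor36_i_of_prop35` with
`TaoTeravainen2021_eq313_holds` / `_eq314_holds`), valid for `η ≥ η₀`; the range `3 ≤ η < η₀` is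
trivial. Constants are ineffective (Siegel).

Everything in this file is PROVED (theorems only; no definition, no named fact). WHAT THIS IS NOT:
no claim about the existence of real zeros; nothing about the conditional Theorem 3 of the note.

## References

* [FriedlanderIwaniec2018Note] J. B. Friedlander, H. Iwaniec, Expo. Math. 36 (2018) 343–350 =
  arXiv:1701.03771, §2 Proposition 2.1 (2.2) (p0003).
* [MontgomeryVaughan2007] H. L. Montgomery, R. C. Vaughan, *Multiplicative Number Theory I*,
  CUP 2007: §1.3 Thm. 1.3 (Abel summation), §2.1 (hyperbola method), §4.3 (4.23), §9.4
  (Pólya–Vinogradov), §11.2 Thm. 11.14 (Siegel).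
* [TaoTeravainen2021] T. Tao, J. Teräväinen, *The Hardy–Littlewood–Chowla conjecture in the
  presence of a Siegel zero*, J. London Math. Soc. (2) 106 (2022), §3.3 Proposition 3.5,
  Corollary 3.6 (first bound).
* [Heathbrown1983] D. R. Heath-Brown, *Prime twins and Siegel zeros*, Proc. London Math. Soc. (3)
  47 (1983), Lemma 3 (the printed input (3.6), replaced here).
-/

noncomputable section

open Finset Real
open Literature.NumberTheory.LFunctions.DirichletAbel
open Literature.NumberTheory.LFunctions.SiegelZero

namespace Literature.NumberTheory.LFunctions

namespace FI2018

variable {q : ℕ} [NeZero q] (χ : DirichletCharacter ℂ q)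

/-! ### §1. Finite Abel summation and tails with a general partial-sum bound `B`

The tree's `ExceptionalPrimesAbel.lean` / `RealCharacterPartialSums.lean` state these with the
trivial bound `|S(N)| ≤ q`; Proposition 2.1 needs them at Pólya–Vinogradov strength, so the bound
`B` is a parameter here (`hB : ∀ n, ‖S(n)‖ ≤ B`). -/

omit [NeZero q] in
/-- Window sums: `‖Σ_{N < n ≤ M} χ(n)‖ ≤ 2B` when all partial sums have norm `≤ B`.
[cite: MontgomeryVaughan2007, §1.3 Thm. 1.3] -/
theorem norm_sum_Ioc_apply_le_of_bound {B : ℝ} (hB : ∀ n, ‖partialSum χ n‖ ≤ B) (N M : ℕ) :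
    ‖∑ n ∈ Ioc N M, χ (n : ZMod q)‖ ≤ 2 * B := by
  have hB0 : 0 ≤ B := (norm_nonneg _).trans (hB 0)
  rcases le_or_gt N M with h | h
  · have hsplit := Finset.sum_Ioc_consecutive (fun n : ℕ => χ (n : ZMod q)) (Nat.zero_le N) h
    have heq : ∑ n ∈ Ioc N M, χ (n : ZMod q) = partialSum χ M - partialSum χ N := by
      rw [SiegelZero.partialSum_eq_sum_Ioc, SiegelZero.partialSum_eq_sum_Ioc, ← hsplit]
      ring
    rw [heq]
    calc ‖partialSum χ M - partialSum χ N‖ ≤ ‖partialSum χ M‖ + ‖partialSum χ N‖ :=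
          norm_sub_le _ _
      _ ≤ B + B := add_le_add (hB M) (hB N)
      _ = 2 * B := by ring
  · rw [Finset.Ioc_eq_empty (by omega), Finset.sum_empty, norm_zero]
    positivity

omit [NeZero q] in
/-- **Finite Abel bound with a partial-sum bound `B`**: if `a(n) ≥ 0` and `a(n+1) ≤ a(n)` for
all `n > N`, then `‖Σ_{N<n≤M} χ(n) a(n)‖ ≤ 2B · a(N+1)`.
[cite: MontgomeryVaughan2007, §1.3 Thm. 1.3] -/
theorem norm_sum_Ioc_mul_le_of_bound {B : ℝ} (hB : ∀ n, ‖partialSum χ n‖ ≤ B) {a : ℕ → ℝ}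
    {N : ℕ} (ha0 : ∀ n, N < n → 0 ≤ a n) (ha : ∀ n, N < n → a (n + 1) ≤ a n) (M : ℕ) :
    ‖∑ n ∈ Ioc N M, χ (n : ZMod q) * (a n : ℂ)‖ ≤ 2 * B * a (N + 1) := by
  have hB0 : 0 ≤ B := (norm_nonneg _).trans (hB 0)
  rcases le_or_gt N M with h | h
  swap
  · rw [Finset.Ioc_eq_empty (by omega), Finset.sum_empty, norm_zero]
    exact mul_nonneg (by positivity) (ha0 _ (Nat.lt_succ_self N))
  have htel : ∑ n ∈ Ioc N M, (a n - a (n + 1)) = a (N + 1) - a (M + 1) := by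
    clear ha0 ha
    induction M, h using Nat.le_induction with
    | base => simp
    | succ M hNM ih => rw [Finset.sum_Ioc_succ_top hNM, ih]; ring
  have key := SiegelZero.sum_Ioc_mul_eq_abel χ (fun n => (a n : ℂ)) h
  simp only at key
  rw [key]
  have hS : ∀ n, ‖∑ k ∈ Ioc N n, χ (k : ZMod q)‖ ≤ 2 * B :=
    fun n => norm_sum_Ioc_apply_le_of_bound χ hB N n
  have haM : 0 ≤ a (M + 1) := ha0 _ (by omega)
  calc ‖(∑ n ∈ Ioc N M, χ (n : ZMod q)) * (a (M + 1) : ℂ) +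
        ∑ n ∈ Ioc N M, (∑ k ∈ Ioc N n, χ (k : ZMod q)) * ((a n : ℂ) - (a (n + 1) : ℂ))‖
      ≤ ‖(∑ n ∈ Ioc N M, χ (n : ZMod q)) * (a (M + 1) : ℂ)‖ +
        ∑ n ∈ Ioc N M, ‖(∑ k ∈ Ioc N n, χ (k : ZMod q)) * ((a n : ℂ) - (a (n + 1) : ℂ))‖ :=
          (norm_add_le _ _).trans (by gcongr; exact norm_sum_le _ _)
    _ ≤ 2 * B * a (M + 1) + ∑ n ∈ Ioc N M, 2 * B * (a n - a (n + 1)) := by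
        gcongr with n hn
        · rw [norm_mul, Complex.norm_real, Real.norm_of_nonneg haM]
          exact mul_le_mul_of_nonneg_right (hS M) haM
        · have hn' : N < n := (Finset.mem_Ioc.mp hn).1
          have hd : 0 ≤ a n - a (n + 1) := sub_nonneg.mpr (ha n hn')
          rw [norm_mul, ← Complex.ofReal_sub, Complex.norm_real, Real.norm_of_nonneg hd]
          exact mul_le_mul_of_nonneg_right (hS n) hd
    _ = 2 * B * a (N + 1) := by
        rw [← Finset.mul_sum, htel]
        ring

omit [NeZero q] in
/-- **Finite Abel bound, real form, with a partial-sum bound `B`**: for a quadratic `χ` and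
`a ≥ 0` non-increasing on `n > N`, `|Σ_{N<n≤M} Re χ(n) · a(n)| ≤ 2B · a(N+1)`.
[cite: MontgomeryVaughan2007, §1.3 Thm. 1.3] -/
theorem abs_sum_Ioc_re_mul_le_of_bound (hq : χ ^ 2 = 1) {B : ℝ} (hB : ∀ n, ‖partialSum χ n‖ ≤ B)
    {a : ℕ → ℝ} {N : ℕ} (ha0 : ∀ n, N < n → 0 ≤ a n) (ha : ∀ n, N < n → a (n + 1) ≤ a n)
    (M : ℕ) :
    |∑ n ∈ Ioc N M, (χ (n : ZMod q)).re * a n| ≤ 2 * B * a (N + 1) := by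
  have h := norm_sum_Ioc_mul_le_of_bound χ hB ha0 ha M
  rwa [SiegelZero.sum_mul_ofReal_eq χ hq, Complex.norm_real, Real.norm_eq_abs] at h

/-- **At a real zero the partial sums are minus the tails** (bound `B`): if `χ ≠ χ₀`, `σ > 0`,
`L(σ, χ) = 0` and `‖S(n)‖ ≤ B` for all `n`, then `‖Σ_{n ≤ N} χ(n) n^{−σ}‖ ≤ 2B (N+1)^{−σ}`.
[cite: MontgomeryVaughan2007, §1.3 Thm. 1.3] -/
theorem norm_sum_Icc_mul_rpow_le_of_LFunction_eq_zero_of_bound (hχ : χ ≠ 1) {B : ℝ}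
    (hB : ∀ n, ‖partialSum χ n‖ ≤ B) {σ : ℝ} (hσ : 0 < σ) (h0 : χ.LFunction σ = 0) (N : ℕ) :
    ‖∑ n ∈ Icc 1 N, χ (n : ZMod q) * (((n : ℝ) ^ (-σ) : ℝ) : ℂ)‖ ≤
      2 * B * ((N + 1 : ℕ) : ℝ) ^ (-σ) := by
  set P : ℕ → ℂ := fun M => ∑ n ∈ Icc 1 M, χ (n : ZMod q) * (((n : ℝ) ^ (-σ) : ℝ) : ℂ) with hP
  -- `P(M) → L(σ, χ) = 0`
  have hlim : Filter.Tendsto P Filter.atTop (nhds 0) := by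
    have h := SiegelZero.tendsto_sum_Icc_mul_cpow χ hχ (s := σ) (by simpa using hσ)
    rw [h0] at h
    refine h.congr fun M => Finset.sum_congr rfl fun n _ => ?_
    rw [Complex.ofReal_cpow (Nat.cast_nonneg n), Complex.ofReal_natCast, Complex.ofReal_neg]
  -- `P(M) = P(N) + window`, the window bounded by `2B (N+1)^{-σ}`
  have hwin : ∀ M, N ≤ M → ‖P N‖ ≤ ‖P M‖ + 2 * B * ((N + 1 : ℕ) : ℝ) ^ (-σ) := by
    intro M hNM
    have hsplit : P M = P N + ∑ n ∈ Ioc N M, χ (n : ZMod q) * (((n : ℝ) ^ (-σ) : ℝ) : ℂ) := by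
      have hI : ∀ K : ℕ, Finset.Icc 1 K = Finset.Ioc 0 K := fun K => by
        ext n; simp only [Finset.mem_Icc, Finset.mem_Ioc]; omega
      simp only [hP]
      rw [hI, hI, ← Finset.sum_Ioc_consecutive _ (Nat.zero_le N) hNM]
    have hW : ‖∑ n ∈ Ioc N M, χ (n : ZMod q) * (((n : ℝ) ^ (-σ) : ℝ) : ℂ)‖ ≤
        2 * B * ((N + 1 : ℕ) : ℝ) ^ (-σ) := by
      have h := norm_sum_Ioc_mul_le_of_bound χ hB (a := fun n : ℕ => (n : ℝ) ^ (-σ)) (N := N)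
        (fun n _ => by positivity) (fun n hn => ?_) M
      · simpa using h
      · have hn0 : (0 : ℝ) < n := by exact_mod_cast (Nat.zero_le N).trans_lt hn
        push_cast
        exact Real.rpow_le_rpow_of_nonpos hn0 (by linarith) (by linarith)
    have hPN : P N = P M - ∑ n ∈ Ioc N M, χ (n : ZMod q) * (((n : ℝ) ^ (-σ) : ℝ) : ℂ) := by
      rw [hsplit]; ring
    calc ‖P N‖ = ‖P M - ∑ n ∈ Ioc N M, χ (n : ZMod q) * (((n : ℝ) ^ (-σ) : ℝ) : ℂ)‖ := by
          rw [hPN]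
      _ ≤ ‖P M‖ + ‖∑ n ∈ Ioc N M, χ (n : ZMod q) * (((n : ℝ) ^ (-σ) : ℝ) : ℂ)‖ := norm_sub_le _ _
      _ ≤ ‖P M‖ + 2 * B * ((N + 1 : ℕ) : ℝ) ^ (-σ) := by gcongr
  -- let `M → ∞`
  have hnorm : Filter.Tendsto (fun M => ‖P M‖ + 2 * B * ((N + 1 : ℕ) : ℝ) ^ (-σ)) Filter.atTop
      (nhds (0 + 2 * B * ((N + 1 : ℕ) : ℝ) ^ (-σ))) := by
    have := (tendsto_norm.comp hlim)
    rw [norm_zero] at this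
    exact this.add tendsto_const_nhds
  have := ge_of_tendsto hnorm (Filter.eventually_atTop.mpr ⟨N, hwin⟩)
  simpa using this

/-- Real form at a zero (bound `B`): for a quadratic `χ ≠ χ₀`, `σ > 0`, `L(σ, χ) = 0`,
`|Σ_{n ≤ N} Re χ(n) · n^{−σ}| ≤ 2B (N+1)^{−σ}`. [cite: MontgomeryVaughan2007, §1.3 Thm. 1.3] -/
theorem abs_sum_Icc_re_mul_rpow_le_of_LFunction_eq_zero_of_bound (hχ : χ ≠ 1) (hq : χ ^ 2 = 1)
    {B : ℝ} (hB : ∀ n, ‖partialSum χ n‖ ≤ B) {σ : ℝ} (hσ : 0 < σ) (h0 : χ.LFunction σ = 0)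
    (N : ℕ) :
    |∑ n ∈ Icc 1 N, (χ (n : ZMod q)).re * (n : ℝ) ^ (-σ)| ≤ 2 * B * ((N + 1 : ℕ) : ℝ) ^ (-σ) := by
  have h := norm_sum_Icc_mul_rpow_le_of_LFunction_eq_zero_of_bound χ hχ hB hσ h0 N
  rwa [SiegelZero.sum_mul_ofReal_eq χ hq, Complex.norm_real, Real.norm_eq_abs] at h

/-- **Harmonic partial sums against `L(1, χ)`, real form, bound `B`**: for a quadratic `χ ≠ χ₀`
with `‖S(n)‖ ≤ B`, `|Σ_{n ≤ N} Re χ(n)/n − Re L(1, χ)| ≤ 2B/(N+1)` (the tree's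
`DirichletAbel.norm_sum_div_sub_LFunction_one_le`, re-indexed).
[cite: MontgomeryVaughan2007, §11.2.1 Exercise 3(a)] -/
theorem abs_sum_Icc_re_div_sub_LFunction_one_le_of_bound (hχ : χ ≠ 1) (hq : χ ^ 2 = 1) {B : ℝ}
    (hB : ∀ n, ‖partialSum χ n‖ ≤ B) (N : ℕ) :
    |∑ n ∈ Icc 1 N, (χ (n : ZMod q)).re / n - (χ.LFunction 1).re| ≤ 2 * B / ((N : ℝ) + 1) := by
  have h := DirichletAbel.norm_sum_div_sub_LFunction_one_le χ hχ hB N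
  have e : ∑ n ∈ range N, χ ((n + 1 : ℕ) : ZMod q) / ((n : ℂ) + 1) =
      ∑ n ∈ Icc 1 N, χ (n : ZMod q) * (((1 : ℝ) / n : ℝ) : ℂ) := by
    have hI : Finset.Icc 1 N = Finset.Ioc 0 N := by
      ext n; simp only [Finset.mem_Icc, Finset.mem_Ioc]; omega
    rw [hI, DirichletAbel.sum_Ioc_eq_sum_range_succ]
    refine Finset.sum_congr rfl fun n _ => ?_
    push_cast
    ring
  rw [e, SiegelZero.sum_mul_ofReal_eq χ hq] at h
  have e2 : χ.LFunction 1 = (((χ.LFunction 1).re : ℝ) : ℂ) := by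
    have := DirichletAbel.LFunction_ofReal_eq_re χ hχ hq one_pos
    rwa [Complex.ofReal_one] at this
  rw [e2, ← Complex.ofReal_sub, Complex.norm_real, Real.norm_eq_abs] at h
  have e3 : ∑ n ∈ Icc 1 N, (χ (n : ZMod q)).re * ((1 : ℝ) / n) =
      ∑ n ∈ Icc 1 N, (χ (n : ZMod q)).re / n := by
    refine Finset.sum_congr rfl fun n _ => ?_
    ring
  rwa [e3] at h

/-! ### §2. Dirichlet's hyperbola rearrangement of `S(D)` -/

omit [NeZero q] in
/-- **`S(D) = Σ_{d ≤ D} χ(d) d^{−β} G_d`**, `G_d = Σ_{m ≤ D/d} m^{−β} (1 − d m/D)` (`λ = 1 ∗ χ`,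
sum over `n = d m`). [cite: MontgomeryVaughan2007, §2.1] -/
theorem smoothSum_natCast_eq (β : ℝ) :
    smoothSum χ β q = ∑ d ∈ Icc 1 q, (χ (d : ZMod q)).re * (d : ℝ) ^ (-β) *
      ∑ m ∈ Icc 1 (q / d), (m : ℝ) ^ (-β) * (1 - (d : ℝ) * m / q) := by
  unfold smoothSum
  rw [Nat.floor_natCast]
  have h1 : ∀ n ∈ Icc 1 q, RealChar.charDivisorSum χ n * (1 - (n : ℝ) / q) * (n : ℝ) ^ (-β) =
      ∑ p ∈ n.divisorsAntidiagonal, (χ (p.1 : ZMod q)).re * (p.1 : ℝ) ^ (-β) *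
        ((p.2 : ℝ) ^ (-β) * (1 - (p.1 : ℝ) * p.2 / q)) := by
    intro n hn
    rw [RealChar.charDivisorSum_apply, Finset.sum_mul, Finset.sum_mul,
      Nat.sum_divisorsAntidiagonal (fun d e => (χ (d : ZMod q)).re * (d : ℝ) ^ (-β) *
        ((e : ℝ) ^ (-β) * (1 - (d : ℝ) * e / q)))]
    refine Finset.sum_congr rfl fun d hd => ?_
    have hdn : d ∣ n := Nat.dvd_of_mem_divisors hd
    have hd0 : d ≠ 0 := (Nat.pos_of_mem_divisors hd).ne'
    have hcast : (n : ℝ) = d * ((n / d : ℕ) : ℝ) := by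
      rw [← Nat.cast_mul, Nat.mul_div_cancel' hdn]
    rw [DirichletAbel.reChar_apply χ hd0, hcast, Real.mul_rpow (Nat.cast_nonneg d) (Nat.cast_nonneg _)]
    ring
  rw [Finset.sum_congr rfl h1,
    Literature.NumberTheory.Sieve.SquarefreeSums.sum_Icc_sum_divisorsAntidiagonal
      (fun d e => (χ (d : ZMod q)).re * (d : ℝ) ^ (-β) *
        ((e : ℝ) ^ (-β) * (1 - (d : ℝ) * e / q))) q]
  refine Finset.sum_congr rfl fun d _ => ?_
  rw [Finset.mul_sum]

end FI2018

/-! ### §3. Power sums and the Riesz mean `G(y) = Σ_{m ≤ y} m^{−β}(1 − m/y)` -/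

namespace FI2018

/-- **The sequence `c_N = Σ_{n ≤ N} n^{−β} − N^{1−β}/(1−β)` is non-increasing with steps
`≤ N^{−β}`**: for `1 ≤ N ≤ M`, `0 ≤ c_N − c_M ≤ N^{−β}` (`0 ≤ β < 1`; the tree's secant bounds
`SiegelZero.sum_Ioc_rpow_bounds`). [folklore] -/
private theorem powerSum_sub_main_antitone {β : ℝ} (hβ0 : 0 ≤ β) (hβ1 : β < 1) {N M : ℕ} (hN : 1 ≤ N)
    (h : N ≤ M) :
    0 ≤ (∑ n ∈ Icc 1 N, (n : ℝ) ^ (-β) - (N : ℝ) ^ (1 - β) / (1 - β)) -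
        (∑ n ∈ Icc 1 M, (n : ℝ) ^ (-β) - (M : ℝ) ^ (1 - β) / (1 - β)) ∧
      (∑ n ∈ Icc 1 N, (n : ℝ) ^ (-β) - (N : ℝ) ^ (1 - β) / (1 - β)) -
        (∑ n ∈ Icc 1 M, (n : ℝ) ^ (-β) - (M : ℝ) ^ (1 - β) / (1 - β)) ≤ (N : ℝ) ^ (-β) := by
  have hI : ∀ K : ℕ, Finset.Icc 1 K = Finset.Ioc 0 K := fun K => by
    ext n; simp only [Finset.mem_Icc, Finset.mem_Ioc]; omega
  have hsplit : ∑ n ∈ Icc 1 M, (n : ℝ) ^ (-β) =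
      ∑ n ∈ Icc 1 N, (n : ℝ) ^ (-β) + ∑ n ∈ Ioc N M, (n : ℝ) ^ (-β) := by
    rw [hI, hI, ← Finset.sum_Ioc_consecutive _ (Nat.zero_le N) h]
  have hb := SiegelZero.sum_Ioc_rpow_bounds hβ0 hβ1 hN h
  have hκ : 0 < 1 - β := by linarith
  have e : ((M : ℝ) ^ (1 - β) - (N : ℝ) ^ (1 - β)) / (1 - β) =
      (M : ℝ) ^ (1 - β) / (1 - β) - (N : ℝ) ^ (1 - β) / (1 - β) := by ring
  rw [e] at hb
  constructor
  · rw [hsplit]; linarith [hb.2]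
  · rw [hsplit]; linarith [hb.1]

/-- **Discrete Abel summation for `Σ m · a(m)`**: with `P(k) = Σ_{m ≤ k} a(m)`,
`Σ_{m ≤ n+1} m a(m) = (n+1) P(n+1) − Σ_{k ≤ n} P(k)` (sum over `1 ≤ k ≤ n`). [folklore] -/
private theorem sum_natCast_mul_eq_abel (a : ℕ → ℝ) (n : ℕ) :
    ∑ m ∈ Icc 1 (n + 1), (m : ℝ) * a m =
      ((n : ℝ) + 1) * ∑ m ∈ Icc 1 (n + 1), a m - ∑ i ∈ range n, ∑ m ∈ Icc 1 (i + 1), a m := by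
  induction n with
  | zero => simp
  | succ n ih =>
    rw [Finset.sum_Icc_succ_top (show 1 ≤ n + 1 + 1 by omega), ih,
      Finset.sum_Icc_succ_top (show 1 ≤ n + 1 + 1 by omega), Finset.sum_range_succ]
    push_cast
    ring

/-- **`Σ_{k ≤ n} k^{u}` against `(n+1)^{1+u}/(1+u)`** (`0 < u ≤ 1`): comparison with `∫ t^u dt`
on `[1, n+1]` and `[0, n]` and the secant bound `(n+1)^{1+u} − n^{1+u} ≤ (1+u)(n+1)^u`:
`(n+1)^{1+u}/(1+u) − (n+1)^u ≤ Σ_{i<n} (i+1)^u ≤ (n+1)^{1+u}/(1+u)`. [folklore] -/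
private theorem sum_range_succ_rpow_bounds {u : ℝ} (hu0 : 0 < u) (hu1 : u ≤ 1) (n : ℕ) :
    ((n : ℝ) + 1) ^ (1 + u) / (1 + u) - ((n : ℝ) + 1) ^ u ≤ ∑ i ∈ range n, ((i : ℝ) + 1) ^ u ∧
      ∑ i ∈ range n, ((i : ℝ) + 1) ^ u ≤ ((n : ℝ) + 1) ^ (1 + u) / (1 + u) := by
  have h1u : 0 < 1 + u := by linarith
  have hmono : ∀ a b : ℝ, MonotoneOn (fun x : ℝ => x ^ u) (Set.Icc a b) ∨ a < 0 := by
    intro a b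
    rcases lt_or_ge a 0 with ha | ha
    · exact Or.inr ha
    · left
      intro x hx y _ hxy
      exact Real.rpow_le_rpow (ha.trans hx.1) hxy hu0.le
  have hmono' : ∀ a b : ℝ, 0 ≤ a → MonotoneOn (fun x : ℝ => x ^ u) (Set.Icc a b) := by
    intro a b ha
    rcases hmono a b with h | h
    · exact h
    · linarith
  constructor
  · -- lower bound: `∫_0^n t^u ≤ Σ_{i<n} (i+1)^u` and `n^{1+u} ≥ (n+1)^{1+u} − (1+u)(n+1)^u`
    have hint := MonotoneOn.integral_le_sum (x₀ := 0) (a := n) (f := fun x : ℝ => x ^ u)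
      (hmono' 0 _ le_rfl)
    simp only [zero_add] at hint
    rw [integral_rpow (Or.inl (by linarith))] at hint
    rw [Real.zero_rpow (show u + 1 ≠ 0 by linarith)] at hint
    have hsum : ∑ i ∈ range n, ((↑(i + 1) : ℝ)) ^ u = ∑ i ∈ range n, ((i : ℝ) + 1) ^ u := by
      refine Finset.sum_congr rfl fun i _ => ?_
      push_cast; ring_nf
    rw [hsum] at hint
    -- secant: `(n+1)^{1+u} - n^{1+u} ≤ (1+u) (n+1)^u`
    have hsec : ((n : ℝ) + 1) ^ (1 + u) - (n : ℝ) ^ (1 + u) ≤ (1 + u) * ((n : ℝ) + 1) ^ u := by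
      rcases Nat.eq_zero_or_pos n with hn | hn
      · subst hn
        simp only [Nat.cast_zero, zero_add, Real.one_rpow, Real.zero_rpow h1u.ne']
        linarith
      · have hn0 : (0 : ℝ) < n := by exact_mod_cast hn
        have hx : (n : ℝ) ≤ n + 1 := by linarith
        -- `x^{1+u} - y^{1+u} = (x - y) x^u + y (x^u - y^u)` with `x = n+1`, `y = n`
        have ex : ((n : ℝ) + 1) ^ (1 + u) = ((n : ℝ) + 1) * ((n : ℝ) + 1) ^ u := by
          rw [Real.rpow_add (by linarith), Real.rpow_one]
        have ey : (n : ℝ) ^ (1 + u) = (n : ℝ) * (n : ℝ) ^ u := by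
          rw [Real.rpow_add hn0, Real.rpow_one]
        have hs := SiegelZero.rpow_sub_rpow_le_mul (κ := u) hn0 hx hu0.le hu1
        have hyu : (n : ℝ) * (n : ℝ) ^ (u - 1) = (n : ℝ) ^ u := by
          rw [Real.rpow_sub hn0, Real.rpow_one]
          field_simp
        have hle : (n : ℝ) ^ u ≤ ((n : ℝ) + 1) ^ u := Real.rpow_le_rpow hn0.le hx hu0.le
        have hkey : (n : ℝ) * (((n : ℝ) + 1) ^ u - (n : ℝ) ^ u) ≤ u * (n : ℝ) ^ u := by
          have := mul_le_mul_of_nonneg_left hs hn0.le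
          calc (n : ℝ) * (((n : ℝ) + 1) ^ u - (n : ℝ) ^ u)
              ≤ (n : ℝ) * (u * (n : ℝ) ^ (u - 1) * ((n : ℝ) + 1 - n)) := this
            _ = u * ((n : ℝ) * (n : ℝ) ^ (u - 1)) := by ring
            _ = u * (n : ℝ) ^ u := by rw [hyu]
        rw [ex, ey]
        nlinarith [hle, hkey, hu0]
    have hdiv : ((n : ℝ) + 1) ^ (1 + u) / (1 + u) - ((n : ℝ) + 1) ^ u ≤
        (n : ℝ) ^ (1 + u) / (1 + u) := by
      rw [sub_le_iff_le_add, div_le_iff₀ h1u]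
      have : ((n : ℝ) ^ (1 + u) / (1 + u) + ((n : ℝ) + 1) ^ u) * (1 + u) =
          (n : ℝ) ^ (1 + u) + (1 + u) * ((n : ℝ) + 1) ^ u := by
        field_simp
      rw [this]
      linarith
    have e2 : (n : ℝ) ^ (u + 1) / (u + 1) = (n : ℝ) ^ (1 + u) / (1 + u) := by
      rw [add_comm u 1]
    rw [sub_zero, e2] at hint
    exact hdiv.trans hint
  · -- upper bound: `Σ_{i<n} (1+i)^u ≤ ∫_1^{1+n} t^u = ((n+1)^{1+u} − 1)/(1+u)`
    have hint := MonotoneOn.sum_le_integral (x₀ := 1) (a := n) (f := fun x : ℝ => x ^ u)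
      (hmono' 1 _ zero_le_one)
    rw [integral_rpow (Or.inl (by linarith))] at hint
    simp only [Real.one_rpow] at hint
    have hsum : ∑ i ∈ range n, ((1 : ℝ) + (i : ℝ)) ^ u = ∑ i ∈ range n, ((i : ℝ) + 1) ^ u := by
      refine Finset.sum_congr rfl fun i _ => ?_
      rw [add_comm]
    rw [hsum] at hint
    refine hint.trans ?_
    rw [add_comm (1 : ℝ) (n : ℝ), add_comm u 1]
    apply div_le_div_of_nonneg_right _ h1u.le
    linarith

/-- `|x₁ + x₂ − x₃ + x₄ − x₅ + x₆| ≤ Σ |xᵢ|`. [folklore] -/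
private theorem abs_add_six_le (x₁ x₂ x₃ x₄ x₅ x₆ : ℝ) :
    |x₁ + x₂ - x₃ + x₄ - x₅ + x₆| ≤ |x₁| + |x₂| + |x₃| + |x₄| + |x₅| + |x₆| := by
  have h1 := abs_add_le (x₁ + x₂ - x₃ + x₄ - x₅) x₆
  have h2 := abs_sub (x₁ + x₂ - x₃ + x₄) x₅
  have h3 := abs_add_le (x₁ + x₂ - x₃) x₄
  have h4 := abs_sub (x₁ + x₂) x₃
  have h5 := abs_add_le x₁ x₂
  linarith

/-- **The Riesz mean `G(y) = Σ_{m ≤ y} m^{−β}(1 − m/y)` against `y^{1−β}/((1−β)(2−β)) + C`.**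
For `2/3 ≤ β < 1`, `u = 1 − β`, an integer `N = n+1 ≤ y < N+1`, `y^u ≤ 7/5`, `log y ≤ 1/(3u)`, and a
constant `C` with `|C| ≤ 1/u + 1` such that `0 ≤ Σ_{m≤k} m^{−β} − k^u/u − C ≤ k^{−β}` for all
`1 ≤ k ≤ N`: `|G(y) − y^u/(u(1+u)) − C| ≤ 7/(u y)`. (Discrete Abel summation for `Σ m · m^{−β}`,
the power-sum comparisons above, and the secant bounds `0 ≤ y^u − N^u ≤ u N^{−β}`,
`0 ≤ y^{1+u} − N^{1+u} ≤ (1+u) y^u`.) This is the tree's elementary rendering of the evaluation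
`S(x) = L(1,χ) x^{1−β}/((1−β)(2−β)) + O(·)` in the proof of Proposition 2.1.
[cite: FriedlanderIwaniec2018Note, §2 (proof of Proposition 2.1)] -/
theorem riesz_powerSum_estimate {β : ℝ} (hβ : 2 / 3 ≤ β) (hβ1 : β < 1) (n : ℕ) {y : ℝ}
    (hNy : (n : ℝ) + 1 ≤ y) (hyN : y < (n : ℝ) + 2) (hyu : y ^ (1 - β) ≤ 7 / 5)
    (hlogy : Real.log y ≤ 1 / (3 * (1 - β))) {C : ℝ} (hC : |C| ≤ 1 / (1 - β) + 1)
    (hP : ∀ k : ℕ, 1 ≤ k → k ≤ n + 1 →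
      0 ≤ ∑ m ∈ Icc 1 k, (m : ℝ) ^ (-β) - (k : ℝ) ^ (1 - β) / (1 - β) - C ∧
        ∑ m ∈ Icc 1 k, (m : ℝ) ^ (-β) - (k : ℝ) ^ (1 - β) / (1 - β) - C ≤ (k : ℝ) ^ (-β)) :
    |∑ m ∈ Icc 1 (n + 1), (m : ℝ) ^ (-β) * (1 - (m : ℝ) / y) -
        y ^ (1 - β) / ((1 - β) * (2 - β)) - C| ≤ 7 / ((1 - β) * y) := by
  -- notation
  set u : ℝ := 1 - β with hu_def
  have hu0 : 0 < u := by rw [hu_def]; linarith only [hβ1]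
  have hu3 : u ≤ 1 / 3 := by rw [hu_def]; linarith only [hβ]
  have hu1 : u ≤ 1 := by linarith only [hu3]
  have h1u : 0 < 1 + u := by linarith only [hu0]
  set N : ℕ := n + 1 with hN_def
  have hN1 : 1 ≤ N := by omega
  have hNpos : (0 : ℝ) < N := by positivity
  have hNr : (N : ℝ) = n + 1 := by rw [hN_def]; push_cast; ring
  have hn0 : (0 : ℝ) ≤ n := Nat.cast_nonneg n
  have hy0 : 0 < y := by linarith only [hNy, hn0]
  have hy1 : 1 ≤ y := by linarith only [hNy, hn0]
  have hNley : (N : ℝ) ≤ y := by rw [hNr]; exact hNy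
  have hyN' : y - N < 1 := by rw [hNr]; linarith only [hyN]
  set P : ℕ → ℝ := fun k => ∑ m ∈ Icc 1 k, (m : ℝ) ^ (-β) with hP_def
  set a : ℝ := (N : ℝ) ^ u with ha_def
  set b : ℝ := y ^ u with hb_def
  have ha0 : 0 < a := Real.rpow_pos_of_pos hNpos u
  have hb0 : 0 < b := Real.rpow_pos_of_pos hy0 u
  have hab : a ≤ b := Real.rpow_le_rpow hNpos.le hNley hu0.le
  have hbE : b ≤ 7 / 5 := hyu
  have haE : a ≤ 7 / 5 := hab.trans hbE
  -- `N^{-β} = a / N`, `N^{1+u} = N a`, `y^{1+u} = y b`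
  have hNβ : (N : ℝ) ^ (-β) = a / N := by
    rw [ha_def, hu_def, show -β = (1 - β) - 1 by ring, Real.rpow_sub hNpos, Real.rpow_one]
  have hN1u : (N : ℝ) ^ (1 + u) = N * a := by
    rw [Real.rpow_add hNpos, Real.rpow_one]
  have hy1u : y ^ (1 + u) = y * b := by
    rw [Real.rpow_add hy0, Real.rpow_one]
  -- (1) `G = P(N) − (1/y) Σ m · m^{-β}` and discrete Abel
  have hG : ∑ m ∈ Icc 1 N, (m : ℝ) ^ (-β) * (1 - (m : ℝ) / y) =
      P N - (1 / y) * ∑ m ∈ Icc 1 N, (m : ℝ) * (m : ℝ) ^ (-β) := by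
    rw [hP_def, Finset.mul_sum, ← Finset.sum_sub_distrib]
    refine Finset.sum_congr rfl fun m _ => ?_
    ring
  have hAbel : ∑ m ∈ Icc 1 N, (m : ℝ) * (m : ℝ) ^ (-β) = N * P N - ∑ i ∈ range n, P (i + 1) := by
    rw [hNr]
    exact sum_natCast_mul_eq_abel (fun m => (m : ℝ) ^ (-β)) n
  -- (2) `P(N) = a/u + C + θN`
  obtain ⟨hθN0, hθN1⟩ := hP N hN1 le_rfl
  set θN : ℝ := P N - (N : ℝ) ^ (1 - β) / (1 - β) - C with hθN_def
  have hPN : P N = a / u + C + θN := by rw [hθN_def, ha_def, hu_def]; ring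
  rw [hNβ] at hθN1
  -- (3) `Σ_{i<n} P(i+1) = (1/u) Σ (i+1)^u + n C + Θ`, `0 ≤ Θ ≤ P N`
  set Θ : ℝ := ∑ i ∈ range n, (P (i + 1) - ((i : ℝ) + 1) ^ u / u - C) with hΘ_def
  have hSumP : ∑ i ∈ range n, P (i + 1) =
      (1 / u) * ∑ i ∈ range n, ((i : ℝ) + 1) ^ u + n * C + Θ := by
    rw [hΘ_def, Finset.mul_sum]
    have : ∀ i ∈ range n, P (i + 1) =
        1 / u * ((i : ℝ) + 1) ^ u + C + (P (i + 1) - ((i : ℝ) + 1) ^ u / u - C) := by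
      intro i _; ring
    rw [Finset.sum_congr rfl this, Finset.sum_add_distrib, Finset.sum_add_distrib,
      Finset.sum_const, Finset.card_range]
    simp
  have hΘ0 : 0 ≤ Θ := by
    rw [hΘ_def]
    refine Finset.sum_nonneg fun i hi => ?_
    have hi' : i + 1 ≤ n + 1 := by have := Finset.mem_range.mp hi; omega
    have h := (hP (i + 1) (by omega) hi').1
    show 0 ≤ ∑ m ∈ Icc 1 (i + 1), (m : ℝ) ^ (-β) - ((i : ℝ) + 1) ^ u / u - C
    push_cast at h
    exact h
  have hΘ1 : Θ ≤ P N := by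
    have hle : Θ ≤ ∑ i ∈ range n, ((i : ℝ) + 1) ^ (-β) := by
      rw [hΘ_def]
      refine Finset.sum_le_sum fun i hi => ?_
      have hi' : i + 1 ≤ n + 1 := by have := Finset.mem_range.mp hi; omega
      have h := (hP (i + 1) (by omega) hi').2
      show ∑ m ∈ Icc 1 (i + 1), (m : ℝ) ^ (-β) - ((i : ℝ) + 1) ^ u / u - C ≤ ((i : ℝ) + 1) ^ (-β)
      push_cast at h
      exact h
    refine hle.trans ?_
    -- `Σ_{i<n} (i+1)^{-β} = Σ_{m ∈ Icc 1 n} m^{-β} ≤ P N`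
    have e : ∑ i ∈ range n, ((i : ℝ) + 1) ^ (-β) = ∑ m ∈ Icc 1 n, (m : ℝ) ^ (-β) := by
      have hI : Finset.Icc 1 n = Finset.Ioc 0 n := by
        ext m; simp only [Finset.mem_Icc, Finset.mem_Ioc]; omega
      rw [hI, DirichletAbel.sum_Ioc_eq_sum_range_succ]
      refine Finset.sum_congr rfl fun i _ => ?_
      push_cast; ring_nf
    rw [e, hP_def]
    exact Finset.sum_le_sum_of_subset_of_nonneg (Finset.Icc_subset_Icc_right (by omega))
      fun m _ _ => Real.rpow_nonneg (Nat.cast_nonneg m) _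
  have hPNle : P N ≤ 1 + a * Real.log N := by
    have := SiegelZero.sum_Icc_rpow_le_log (by linarith : (0 : ℝ) ≤ β) hβ1 hN1
    rw [hP_def, ha_def, hu_def]
    exact this
  have hlogN : Real.log N ≤ 1 / (3 * u) := by
    refine le_trans (Real.log_le_log hNpos hNley) ?_
    rw [hu_def]; exact hlogy
  have hlogN0 : 0 ≤ Real.log N := Real.log_nonneg (by exact_mod_cast hN1)
  -- (4) `Σ_{i<n} (i+1)^u = N^{1+u}/(1+u) − θ'`, `0 ≤ θ' ≤ a`
  obtain ⟨hS1, hS2⟩ := sum_range_succ_rpow_bounds hu0 hu1 n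
  set θ' : ℝ := ((n : ℝ) + 1) ^ (1 + u) / (1 + u) - ∑ i ∈ range n, ((i : ℝ) + 1) ^ u with hθ'_def
  have hθ'0 : 0 ≤ θ' := by rw [hθ'_def]; linarith only [hS2]
  have hθ'1 : θ' ≤ a := by
    rw [hθ'_def, ha_def, hNr]; linarith only [hS1]
  have hSumU : ∑ i ∈ range n, ((i : ℝ) + 1) ^ u = N * a / (1 + u) - θ' := by
    rw [hθ'_def, ← hNr, hN1u]; ring
  -- (5) the secant bounds in `y`
  have hfloor : ⌊y⌋₊ = N := by
    rw [hN_def]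
    have h1 : ((n + 1 : ℕ) : ℝ) ≤ y := by push_cast; exact hNy
    have h2 : y < ((n + 1 : ℕ) : ℝ) + 1 := by push_cast; linarith only [hyN]
    exact Nat.floor_eq_iff hy0.le |>.mpr ⟨h1, h2⟩
  have hsec1 : 0 ≤ b - a ∧ b - a ≤ u * (a / N) := by
    have h := SiegelZero.rpow_sub_floor_rpow_bounds (by linarith : (0 : ℝ) ≤ β) hβ1 hy1
    rw [hfloor, hNβ] at h
    rw [hb_def, ha_def, hu_def]
    exact h
  have hsec2 : 0 ≤ y * b - N * a ∧ y * b - N * a ≤ (1 + u) * b := by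
    have e : y * b - N * a = (y - N) * b + N * (b - a) := by ring
    rw [e]
    constructor
    · exact add_nonneg (mul_nonneg (sub_nonneg.mpr hNley) hb0.le)
        (mul_nonneg hNpos.le (sub_nonneg.mpr hab))
    · -- `(y − N) b + N (b − a) ≤ b + N · u · a/N = b + u a ≤ (1+u) b`
      have h1 : (y - N) * b ≤ 1 * b := mul_le_mul_of_nonneg_right hyN'.le hb0.le
      have h2 : (N : ℝ) * (b - a) ≤ u * a := by
        have := mul_le_mul_of_nonneg_left hsec1.2 hNpos.le
        calc (N : ℝ) * (b - a) ≤ N * (u * (a / N)) := this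
          _ = u * a := by field_simp
      have h3 : u * a ≤ u * b := mul_le_mul_of_nonneg_left hab hu0.le
      have e2 : (1 + u) * b = 1 * b + u * b := by ring
      rw [e2]
      linarith only [h1, h2, h3]
  -- (6) the identity `G − T = (a−b)/u + (yb − Na)/((1+u)y) − C/y + θN(1−N/y) − θ'/(uy) + Θ/y`
  have hβ2 : 2 - β = 1 + u := by rw [hu_def]; ring
  have hGT : ∑ m ∈ Icc 1 N, (m : ℝ) ^ (-β) * (1 - (m : ℝ) / y) - y ^ (1 - β) / ((1 - β) * (2 - β)) - C
      = (a - b) / u + (y * b - N * a) / ((1 + u) * y) - C / y + θN * (1 - N / y)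
        - θ' / (u * y) + Θ / y := by
    rw [hG, hAbel, hSumP, hSumU, hPN, hβ2, ← hu_def, ← hb_def]
    have hn : (n : ℝ) = N - 1 := by rw [hNr]; ring
    rw [hn]
    field_simp
    ring
  -- (7) bound each term
  rw [hGT]
  have hy2N : 1 / (N : ℝ) ≤ 2 / y := by
    rw [div_le_div_iff₀ hNpos hy0]
    have : y < (N : ℝ) + 1 := by linarith only [hyN']
    have hN1r : (1 : ℝ) ≤ N := by exact_mod_cast hN1
    linarith only [this, hN1r]
  have t1 : |(a - b) / u| ≤ 2 * (7 / 5) / y := by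
    rw [abs_div, abs_of_pos hu0, abs_sub_comm, abs_of_nonneg hsec1.1, div_le_iff₀ hu0]
    calc b - a ≤ u * (a / N) := hsec1.2
      _ = u * (a * (1 / N)) := by ring
      _ ≤ u * ((7 / 5) * (2 / y)) := by gcongr
      _ = 2 * (7 / 5) / y * u := by ring
  have t2 : |(y * b - N * a) / ((1 + u) * y)| ≤ (7 / 5) / y := by
    rw [abs_div, abs_of_nonneg hsec2.1, abs_of_pos (by positivity), div_le_div_iff₀ (by positivity) hy0]
    calc (y * b - N * a) * y ≤ (1 + u) * b * y := by
          exact mul_le_mul_of_nonneg_right hsec2.2 hy0.le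
      _ ≤ (1 + u) * (7 / 5) * y := by gcongr
      _ = 7 / 5 * ((1 + u) * y) := by ring
  have t3 : |C / y| ≤ (1 / u + 1) / y := by
    rw [abs_div, abs_of_pos hy0]
    exact div_le_div_of_nonneg_right (by rw [hu_def]; exact hC) hy0.le
  have t4 : |θN * (1 - N / y)| ≤ 2 * (7 / 5) / y := by
    have h01 : 0 ≤ 1 - (N : ℝ) / y := by
      rw [sub_nonneg, div_le_one hy0]; exact hNley
    have h11 : 1 - (N : ℝ) / y ≤ 1 := by
      have : 0 ≤ (N : ℝ) / y := by positivity
      linarith only [this]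
    rw [abs_mul, abs_of_nonneg hθN0, abs_of_nonneg h01]
    calc θN * (1 - N / y) ≤ (a / N) * 1 := by gcongr
      _ = a * (1 / N) := by ring
      _ ≤ (7 / 5) * (2 / y) := by gcongr
      _ = 2 * (7 / 5) / y := by ring
  have t5 : |θ' / (u * y)| ≤ (7 / 5) / (u * y) := by
    rw [abs_div, abs_of_nonneg hθ'0, abs_of_pos (by positivity)]
    gcongr
    exact hθ'1.trans haE
  have t6 : |Θ / y| ≤ (1 + (7 / 5) * (1 / (3 * u))) / y := by
    rw [abs_div, abs_of_nonneg hΘ0, abs_of_pos hy0]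
    gcongr
    calc Θ ≤ P N := hΘ1
      _ ≤ 1 + a * Real.log N := hPNle
      _ ≤ 1 + (7 / 5) * (1 / (3 * u)) := by gcongr
  -- (8) add up: `≤ 9/y + (43/15)/(u y) ≤ 7/(u y)` since `u ≤ 1/3`
  have hsum := abs_add_six_le ((a - b) / u) ((y * b - N * a) / ((1 + u) * y)) (C / y)
      (θN * (1 - N / y)) (θ' / (u * y)) (Θ / y)
  have htot : |(a - b) / u + (y * b - N * a) / ((1 + u) * y) - C / y + θN * (1 - N / y)
      - θ' / (u * y) + Θ / y| ≤
      2 * (7 / 5) / y + (7 / 5) / y + (1 / u + 1) / y + 2 * (7 / 5) / y + (7 / 5) / (u * y)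
        + (1 + (7 / 5) * (1 / (3 * u))) / y := by
    linarith only [hsum, t1, t2, t3, t4, t5, t6]
  refine htot.trans ?_
  have huy : 0 < u * y := by positivity
  have hkey : 2 * (7 / 5) / y + (7 / 5) / y + (1 / u + 1) / y + 2 * (7 / 5) / y + (7 / 5) / (u * y)
      + (1 + (7 / 5) * (1 / (3 * u))) / y = (9 * u + 43 / 15) / (u * y) := by
    field_simp
    ring
  rw [hkey]
  apply div_le_div_of_nonneg_right _ huy.le
  linarith only [hu3]


/-! ### §4. The term-by-term estimate, the decomposition of `S(D)`, and the error bound -/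

/-- `e^{1/3} ≤ 7/5` (from Mathlib's `Real.exp_one_lt_d9`: `(7/5)³ = 2.744 > e`). [folklore] -/
private theorem exp_one_third_le : Real.exp (1 / 3) ≤ 7 / 5 := by
  have h3 : Real.exp (1 / 3) ^ 3 = Real.exp 1 := by
    rw [← Real.exp_nat_mul]; norm_num
  have hlt : Real.exp (1 / 3) ^ 3 < (7 / 5 : ℝ) ^ 3 := by
    rw [h3]
    exact Real.exp_one_lt_d9.trans (by norm_num)
  exact (lt_of_pow_lt_pow_left₀ 3 (by norm_num) hlt).le

/-- Under `1 − β ≤ (3 log D)^{−1}` with `D ≥ 3`: `2/3 ≤ β`, `log D ≤ 1/(3(1−β))` and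
`D^{1−β} ≤ e^{1/3} ≤ 7/5`. [cite: FriedlanderIwaniec2018Note, §2] -/
theorem close_zero_facts {D : ℕ} (hD : 3 ≤ D) {β : ℝ} (hβ1 : β < 1)
    (hclose : 1 - β ≤ 1 / (3 * Real.log D)) :
    2 / 3 ≤ β ∧ Real.log D ≤ 1 / (3 * (1 - β)) ∧ (D : ℝ) ^ (1 - β) ≤ 7 / 5 := by
  have hD' : (3 : ℝ) ≤ D := by exact_mod_cast hD
  have hlog1 : 1 ≤ Real.log D := by
    rw [Real.le_log_iff_exp_le (by linarith)]
    exact (Real.exp_one_lt_d9.le.trans (by norm_num)).trans hD'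
  have hlog0 : 0 < Real.log D := by linarith
  have hu0 : 0 < 1 - β := by linarith
  have h1 : (1 - β) * Real.log D ≤ 1 / 3 := by
    rw [le_div_iff₀ (by positivity)] at hclose
    linarith
  refine ⟨?_, ?_, ?_⟩
  · have : 1 - β ≤ 1 / 3 := by
      calc 1 - β = (1 - β) * 1 := (mul_one _).symm
        _ ≤ (1 - β) * Real.log D := mul_le_mul_of_nonneg_left hlog1 hu0.le
        _ ≤ 1 / 3 := h1
    linarith
  · rw [le_div_iff₀ (by positivity)]
    linarith
  · have hD0 : (0 : ℝ) < D := by linarith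
    rw [Real.rpow_def_of_pos hD0]
    calc Real.exp (Real.log D * (1 - β)) ≤ Real.exp (1 / 3) :=
          Real.exp_le_exp.mpr (by linarith)
      _ ≤ 7 / 5 := exp_one_third_le

/-- **Term-by-term estimate**: for `1 ≤ d ≤ D`, with `y = D/d` and
`C = Σ_{m ≤ D} m^{−β} − D^{1−β}/(1−β)`,
`|G_d − y^{1−β}/((1−β)(2−β)) − C| ≤ 7 d/((1−β) D)`, `G_d = Σ_{m ≤ D/d} m^{−β}(1 − d m/D)`
(`riesz_powerSum_estimate` at `N = D/d = ⌊y⌋`).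
[cite: FriedlanderIwaniec2018Note, §2 (proof of Proposition 2.1)] -/
theorem riesz_term_estimate {D : ℕ} {β : ℝ} (hβ : 2 / 3 ≤ β) (hβ1 : β < 1)
    (hDu : (D : ℝ) ^ (1 - β) ≤ 7 / 5) (hlogD : Real.log D ≤ 1 / (3 * (1 - β)))
    {d : ℕ} (hd : 1 ≤ d) (hdD : d ≤ D) :
    |∑ m ∈ Icc 1 (D / d), (m : ℝ) ^ (-β) * (1 - (d : ℝ) * m / D)
        - ((D : ℝ) / d) ^ (1 - β) / ((1 - β) * (2 - β))
        - (∑ m ∈ Icc 1 D, (m : ℝ) ^ (-β) - (D : ℝ) ^ (1 - β) / (1 - β))|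
      ≤ 7 * d / ((1 - β) * D) := by
  have hβ0 : (0 : ℝ) ≤ β := by linarith
  have hu0 : 0 < 1 - β := by linarith
  have hD1 : 1 ≤ D := hd.trans hdD
  have hDpos : (0 : ℝ) < D := by exact_mod_cast hD1
  have hdpos : (0 : ℝ) < d := by exact_mod_cast hd
  set y : ℝ := (D : ℝ) / d with hy_def
  have hy0 : 0 < y := div_pos hDpos hdpos
  have hyD : y ≤ D := by
    rw [hy_def, div_le_iff₀ hdpos]
    have : (1 : ℝ) ≤ d := by exact_mod_cast hd
    nlinarith
  -- `N = D / d = ⌊y⌋ ≥ 1`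
  set N : ℕ := D / d with hN_def
  have hN1 : 1 ≤ N := by
    rw [hN_def]
    exact (Nat.le_div_iff_mul_le hd).mpr (by simpa using hdD)
  have hfloor : ⌊y⌋₊ = N := by rw [hy_def, hN_def]; exact Nat.floor_div_eq_div D d
  obtain ⟨n, hn⟩ : ∃ n : ℕ, N = n + 1 := ⟨N - 1, by omega⟩
  have hNy : (n : ℝ) + 1 ≤ y := by
    have : (N : ℝ) ≤ y := by rw [← hfloor]; exact Nat.floor_le hy0.le
    rw [hn] at this; push_cast at this; exact this
  have hyN : y < (n : ℝ) + 2 := by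
    have : y < (⌊y⌋₊ : ℝ) + 1 := Nat.lt_floor_add_one y
    rw [hfloor, hn] at this; push_cast at this; linarith
  have hyu : y ^ (1 - β) ≤ 7 / 5 := (Real.rpow_le_rpow hy0.le hyD hu0.le).trans hDu
  have hlogy : Real.log y ≤ 1 / (3 * (1 - β)) := (Real.log_le_log hy0 hyD).trans hlogD
  have hC : |∑ m ∈ Icc 1 D, (m : ℝ) ^ (-β) - (D : ℝ) ^ (1 - β) / (1 - β)| ≤ 1 / (1 - β) + 1 :=
    (SiegelZero.abs_sum_Icc_rpow_sub_le hβ0 hβ1 hD1).trans (by linarith)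
  have hP : ∀ k : ℕ, 1 ≤ k → k ≤ n + 1 →
      0 ≤ ∑ m ∈ Icc 1 k, (m : ℝ) ^ (-β) - (k : ℝ) ^ (1 - β) / (1 - β) -
          (∑ m ∈ Icc 1 D, (m : ℝ) ^ (-β) - (D : ℝ) ^ (1 - β) / (1 - β)) ∧
        ∑ m ∈ Icc 1 k, (m : ℝ) ^ (-β) - (k : ℝ) ^ (1 - β) / (1 - β) -
          (∑ m ∈ Icc 1 D, (m : ℝ) ^ (-β) - (D : ℝ) ^ (1 - β) / (1 - β)) ≤ (k : ℝ) ^ (-β) := by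
    intro k hk1 hkN
    have hkD : k ≤ D := by
      rw [← hn] at hkN
      exact hkN.trans (hN_def ▸ Nat.div_le_self D d)
    exact powerSum_sub_main_antitone hβ0 hβ1 hk1 hkD
  have h := riesz_powerSum_estimate hβ hβ1 n hNy hyN hyu hlogy hC hP
  -- convert the weights `1 − d m/D = 1 − m/y` and the index `n + 1 = D/d`
  have hsum : ∑ m ∈ Icc 1 (D / d), (m : ℝ) ^ (-β) * (1 - (d : ℝ) * m / D) =
      ∑ m ∈ Icc 1 (n + 1), (m : ℝ) ^ (-β) * (1 - (m : ℝ) / y) := by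
    rw [← hN_def, hn]
    refine Finset.sum_congr rfl fun m _ => ?_
    rw [hy_def]
    field_simp
  rw [hsum]
  refine h.trans (le_of_eq ?_)
  rw [hy_def]
  field_simp

/-- **The inner Riesz sums `G_d = Σ_{m ≤ D/d} m^{−β}(1 − d m/D)` are non-negative,
bounded by `Σ_{m ≤ D/d} m^{−β}`, and non-increasing in `d ≥ 1`.** [folklore] -/
private theorem riesz_inner_nonneg {D : ℕ} (β : ℝ) (d : ℕ) :
    0 ≤ ∑ m ∈ Icc 1 (D / d), (m : ℝ) ^ (-β) * (1 - (d : ℝ) * m / D) := by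
  refine Finset.sum_nonneg fun m hm => mul_nonneg (Real.rpow_nonneg (Nat.cast_nonneg m) _) ?_
  rcases Nat.eq_zero_or_pos d with hd | hd
  · subst hd; simp
  have hmD : d * m ≤ D := by
    have := (Finset.mem_Icc.mp hm).2
    rw [mul_comm]; exact (Nat.le_div_iff_mul_le hd).mp this
  have hD : (0 : ℝ) < D := by
    have : 0 < D := lt_of_lt_of_le (Nat.mul_pos hd (Finset.mem_Icc.mp hm).1) hmD
    exact_mod_cast this
  rw [sub_nonneg, div_le_one hD]
  exact_mod_cast hmD

/-- `G_d ≤ Σ_{m ≤ D/d} m^{−β}`. [folklore] -/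
private theorem riesz_inner_le_powerSum {D : ℕ} (β : ℝ) (d : ℕ) :
    ∑ m ∈ Icc 1 (D / d), (m : ℝ) ^ (-β) * (1 - (d : ℝ) * m / D) ≤
      ∑ m ∈ Icc 1 (D / d), (m : ℝ) ^ (-β) := by
  refine Finset.sum_le_sum fun m _ => ?_
  have h0 : 0 ≤ (m : ℝ) ^ (-β) := Real.rpow_nonneg (Nat.cast_nonneg m) _
  have h1 : 1 - (d : ℝ) * m / D ≤ 1 := by
    have : 0 ≤ (d : ℝ) * m / D := by positivity
    linarith
  calc (m : ℝ) ^ (-β) * (1 - (d : ℝ) * m / D) ≤ (m : ℝ) ^ (-β) * 1 :=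
        mul_le_mul_of_nonneg_left h1 h0
    _ = (m : ℝ) ^ (-β) := mul_one _

/-- `G_{d+1} ≤ G_d` for `d ≥ 1` (`0 ≤ β`). [folklore] -/
private theorem riesz_inner_antitone {D : ℕ} {β : ℝ} {d : ℕ} (hd : 1 ≤ d) :
    ∑ m ∈ Icc 1 (D / (d + 1)), (m : ℝ) ^ (-β) * (1 - ((d + 1 : ℕ) : ℝ) * m / D) ≤
      ∑ m ∈ Icc 1 (D / d), (m : ℝ) ^ (-β) * (1 - (d : ℝ) * m / D) := by
  have hsub : Finset.Icc 1 (D / (d + 1)) ⊆ Finset.Icc 1 (D / d) :=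
    Finset.Icc_subset_Icc_right (Nat.div_le_div_left (Nat.le_succ d) hd)
  calc ∑ m ∈ Icc 1 (D / (d + 1)), (m : ℝ) ^ (-β) * (1 - ((d + 1 : ℕ) : ℝ) * m / D)
      ≤ ∑ m ∈ Icc 1 (D / (d + 1)), (m : ℝ) ^ (-β) * (1 - (d : ℝ) * m / D) := by
        refine Finset.sum_le_sum fun m _ => ?_
        refine mul_le_mul_of_nonneg_left ?_ (Real.rpow_nonneg (Nat.cast_nonneg m) _)
        have : (0 : ℝ) ≤ (m : ℝ) / D := by positivity
        push_cast
        have e : ((d : ℝ) + 1) * m / D = (d : ℝ) * m / D + (m : ℝ) / D := by ring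
        rw [e]; linarith
    _ ≤ ∑ m ∈ Icc 1 (D / d), (m : ℝ) ^ (-β) * (1 - (d : ℝ) * m / D) := by
        refine Finset.sum_le_sum_of_subset_of_nonneg hsub fun m hm _ => ?_
        refine mul_nonneg (Real.rpow_nonneg (Nat.cast_nonneg m) _) ?_
        have hmD : d * m ≤ D := by
          rw [mul_comm]; exact (Nat.le_div_iff_mul_le hd).mp (Finset.mem_Icc.mp hm).2
        have hD : (0 : ℝ) < D := by
          have : 0 < D := lt_of_lt_of_le (Nat.mul_pos hd (Finset.mem_Icc.mp hm).1) hmD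
          exact_mod_cast this
        rw [sub_nonneg, div_le_one hD]
        exact_mod_cast hmD

/-- **Decomposition of `S(D)`**: with `u = 1 − β`, `M₁ = D^u/(u(1+u))`,
`C = Σ_{m ≤ D} m^{−β} − D^u/u` and `R_d = G_d − (D/d)^u/(u(1+u)) − C`,
`S(D) = M₁ Σ_{d ≤ D} χ(d)/d + C Σ_{d ≤ D} χ(d) d^{−β} + Σ_{d ≤ D} χ(d) d^{−β} R_d`
(`d^{−β} (D/d)^u = D^u/d`). [cite: FriedlanderIwaniec2018Note, §2 (2.1)] -/
theorem smoothSum_decomposition {D : ℕ} [NeZero D] (χ : DirichletCharacter ℂ D) {β : ℝ}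
    (hβ1 : β < 1) :
    smoothSum χ β D =
      (D : ℝ) ^ (1 - β) / ((1 - β) * (2 - β)) * ∑ d ∈ Icc 1 D, (χ (d : ZMod D)).re / d
      + (∑ m ∈ Icc 1 D, (m : ℝ) ^ (-β) - (D : ℝ) ^ (1 - β) / (1 - β)) *
          ∑ d ∈ Icc 1 D, (χ (d : ZMod D)).re * (d : ℝ) ^ (-β)
      + ∑ d ∈ Icc 1 D, (χ (d : ZMod D)).re * (d : ℝ) ^ (-β) *
          (∑ m ∈ Icc 1 (D / d), (m : ℝ) ^ (-β) * (1 - (d : ℝ) * m / D)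
            - ((D : ℝ) / d) ^ (1 - β) / ((1 - β) * (2 - β))
            - (∑ m ∈ Icc 1 D, (m : ℝ) ^ (-β) - (D : ℝ) ^ (1 - β) / (1 - β))) := by
  rw [smoothSum_natCast_eq, Finset.mul_sum, Finset.mul_sum, ← Finset.sum_add_distrib,
    ← Finset.sum_add_distrib]
  refine Finset.sum_congr rfl fun d hd => ?_
  have hd1 : 1 ≤ d := (Finset.mem_Icc.mp hd).1
  have hdpos : (0 : ℝ) < d := by exact_mod_cast hd1
  have hD0 : (0 : ℝ) ≤ D := Nat.cast_nonneg D
  have key : (d : ℝ) ^ (-β) * ((D : ℝ) / d) ^ (1 - β) = (D : ℝ) ^ (1 - β) / d := by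
    rw [Real.div_rpow hD0 hdpos.le, show -β = (-1) + (1 - β) by ring,
      Real.rpow_add hdpos, Real.rpow_neg_one]
    have : (d : ℝ) ^ (1 - β) ≠ 0 := (Real.rpow_pos_of_pos hdpos _).ne'
    field_simp
  have hu : (1 - β) * (2 - β) ≠ 0 := by
    apply mul_ne_zero <;> linarith
  linear_combination ((χ (d : ZMod D)).re / ((1 - β) * (2 - β))) * key

/-- **Long range** `d ≤ D₀`: `|Σ_{d ≤ D₀} χ(d) d^{−β} R_d| ≤ (49/5) D₀/((1−β) D)`
(`|R_d| ≤ 7d/((1−β)D)`, `d^{−β} d = d^{1−β} ≤ D^{1−β} ≤ 7/5`).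
[cite: FriedlanderIwaniec2018Note, §2 (proof of Proposition 2.1)] -/
theorem abs_longRange_le {D : ℕ} [NeZero D] (χ : DirichletCharacter ℂ D) {β : ℝ}
    (hβ : 2 / 3 ≤ β) (hβ1 : β < 1) (hDu : (D : ℝ) ^ (1 - β) ≤ 7 / 5)
    (hlogD : Real.log D ≤ 1 / (3 * (1 - β))) {D₀ : ℕ} (hD₀ : D₀ ≤ D) :
    |∑ d ∈ Icc 1 D₀, (χ (d : ZMod D)).re * (d : ℝ) ^ (-β) *
        (∑ m ∈ Icc 1 (D / d), (m : ℝ) ^ (-β) * (1 - (d : ℝ) * m / D)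
          - ((D : ℝ) / d) ^ (1 - β) / ((1 - β) * (2 - β))
          - (∑ m ∈ Icc 1 D, (m : ℝ) ^ (-β) - (D : ℝ) ^ (1 - β) / (1 - β)))|
      ≤ 49 / 5 * D₀ / ((1 - β) * D) := by
  have hu0 : 0 < 1 - β := by linarith
  refine (Finset.abs_sum_le_sum_abs _ _).trans ?_
  have hterm : ∀ d ∈ Icc 1 D₀, |(χ (d : ZMod D)).re * (d : ℝ) ^ (-β) *
      (∑ m ∈ Icc 1 (D / d), (m : ℝ) ^ (-β) * (1 - (d : ℝ) * m / D)
        - ((D : ℝ) / d) ^ (1 - β) / ((1 - β) * (2 - β))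
        - (∑ m ∈ Icc 1 D, (m : ℝ) ^ (-β) - (D : ℝ) ^ (1 - β) / (1 - β)))|
      ≤ 49 / 5 / ((1 - β) * D) := by
    intro d hd
    have hd1 : 1 ≤ d := (Finset.mem_Icc.mp hd).1
    have hdD : d ≤ D := (Finset.mem_Icc.mp hd).2.trans hD₀
    have hdpos : (0 : ℝ) < d := by exact_mod_cast hd1
    have hDpos : (0 : ℝ) < D := by exact_mod_cast hd1.trans hdD
    have hR := riesz_term_estimate hβ hβ1 hDu hlogD hd1 hdD
    rw [abs_mul, abs_mul]
    have ha : |(χ (d : ZMod D)).re| ≤ 1 := (Complex.abs_re_le_norm _).trans (χ.norm_le_one _)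
    have hdb : |(d : ℝ) ^ (-β)| = (d : ℝ) ^ (-β) := abs_of_nonneg (Real.rpow_nonneg hdpos.le _)
    rw [hdb]
    -- `d^{-β} · (7 d) = 7 d^{1-β} ≤ 7 · D^{1-β} ≤ 49/5`
    have hdu : (d : ℝ) ^ (-β) * d = (d : ℝ) ^ (1 - β) := by
      rw [show (1 - β) = -β + 1 by ring, Real.rpow_add hdpos, Real.rpow_one]
    have hdu' : (d : ℝ) ^ (1 - β) ≤ 7 / 5 :=
      (Real.rpow_le_rpow hdpos.le (by exact_mod_cast hdD) hu0.le).trans hDu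
    calc |(χ (d : ZMod D)).re| * (d : ℝ) ^ (-β) * |_|
        ≤ 1 * (d : ℝ) ^ (-β) * (7 * d / ((1 - β) * D)) := by
          gcongr
      _ = 7 * ((d : ℝ) ^ (-β) * d) / ((1 - β) * D) := by ring
      _ ≤ 7 * (7 / 5) / ((1 - β) * D) := by
          rw [hdu]; gcongr
      _ = 49 / 5 / ((1 - β) * D) := by ring
  calc ∑ d ∈ Icc 1 D₀, |(χ (d : ZMod D)).re * (d : ℝ) ^ (-β) *
        (∑ m ∈ Icc 1 (D / d), (m : ℝ) ^ (-β) * (1 - (d : ℝ) * m / D)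
          - ((D : ℝ) / d) ^ (1 - β) / ((1 - β) * (2 - β))
          - (∑ m ∈ Icc 1 D, (m : ℝ) ^ (-β) - (D : ℝ) ^ (1 - β) / (1 - β)))|
      ≤ ∑ d ∈ Icc 1 D₀, 49 / 5 / ((1 - β) * D) := Finset.sum_le_sum hterm
    _ = 49 / 5 * D₀ / ((1 - β) * D) := by
        rw [Finset.sum_const, Nat.card_Icc, Nat.add_sub_cancel, nsmul_eq_mul]
        ring


/-- `d^{−β} (D/d)^{1−β} = D^{1−β}/d` (`d > 0`). [folklore] -/
private theorem rpow_neg_mul_div_rpow {d D β : ℝ} (hd : 0 < d) (hD : 0 ≤ D) :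
    d ^ (-β) * (D / d) ^ (1 - β) = D ^ (1 - β) / d := by
  rw [Real.div_rpow hD hd.le, show -β = (-1) + (1 - β) by ring, Real.rpow_add hd,
    Real.rpow_neg_one]
  have : d ^ (1 - β) ≠ 0 := (Real.rpow_pos_of_pos hd _).ne'
  field_simp

/-- `(N+1)^{−β} ≤ (7/5)/(N+1)` when `N + 1 ≤ D` and `D^{1−β} ≤ 7/5` (`β < 1`). [folklore] -/
private theorem rpow_neg_le_div {D N : ℕ} {β : ℝ} (hβ1 : β < 1) (hDu : (D : ℝ) ^ (1 - β) ≤ 7 / 5)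
    (hN : N + 1 ≤ D) :
    ((N : ℝ) + 1) ^ (-β) ≤ (7 / 5) / ((N : ℝ) + 1) := by
  have hN0 : (0 : ℝ) < (N : ℝ) + 1 := by positivity
  have hND : (N : ℝ) + 1 ≤ D := by exact_mod_cast hN
  have e : ((N : ℝ) + 1) ^ (-β) = ((N : ℝ) + 1) ^ (1 - β) / ((N : ℝ) + 1) := by
    rw [show (1 - β) = -β + 1 by ring, Real.rpow_add hN0, Real.rpow_one]
    field_simp
  rw [e]
  exact div_le_div_of_nonneg_right
    ((Real.rpow_le_rpow hN0.le hND (by linarith)).trans hDu) hN0.le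

/-- **Short range** `D₀ < d ≤ D`: three finite Abel summations against the non-increasing
weights `d^{−β} G_d`, `1/d`, `d^{−β}` give
`|Σ_{D₀<d≤D} χ(d) d^{−β} R_d| ≤ 8B/((1−β)(D₀+1))` (`B` a bound for the partial sums of `χ`).
[cite: MontgomeryVaughan2007, §1.3 Thm. 1.3] -/
theorem abs_shortRange_le {D : ℕ} [NeZero D] (χ : DirichletCharacter ℂ D) (hq : χ ^ 2 = 1)
    {B : ℝ} (hB : ∀ n, ‖partialSum χ n‖ ≤ B) {β : ℝ} (hβ : 2 / 3 ≤ β) (hβ1 : β < 1)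
    (hDu : (D : ℝ) ^ (1 - β) ≤ 7 / 5) (hlogD : Real.log D ≤ 1 / (3 * (1 - β))) {D₀ : ℕ}
    (hD₀ : D₀ < D) :
    |∑ d ∈ Ioc D₀ D, (χ (d : ZMod D)).re * (d : ℝ) ^ (-β) *
        (∑ m ∈ Icc 1 (D / d), (m : ℝ) ^ (-β) * (1 - (d : ℝ) * m / D)
          - ((D : ℝ) / d) ^ (1 - β) / ((1 - β) * (2 - β))
          - (∑ m ∈ Icc 1 D, (m : ℝ) ^ (-β) - (D : ℝ) ^ (1 - β) / (1 - β)))|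
      ≤ 8 * B / ((1 - β) * ((D₀ : ℝ) + 1)) := by
  have hβ0 : (0 : ℝ) ≤ β := by linarith
  set u : ℝ := 1 - β with hu_def
  have hu0 : 0 < u := by rw [hu_def]; linarith only [hβ1]
  have hu3 : u ≤ 1 / 3 := by rw [hu_def]; linarith only [hβ]
  have hB0 : 0 ≤ B := (norm_nonneg _).trans (hB 0)
  have hD1 : 1 ≤ D := by omega
  have hDpos : (0 : ℝ) < D := by exact_mod_cast hD1
  have hD₀1 : D₀ + 1 ≤ D := hD₀
  have hD₀pos : (0 : ℝ) < (D₀ : ℝ) + 1 := by positivity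
  have hlogD' : Real.log D ≤ 1 / (3 * u) := by rw [hu_def]; exact hlogD
  -- abbreviations (as functions of `d`)
  set G : ℕ → ℝ := fun d => ∑ m ∈ Icc 1 (D / d), (m : ℝ) ^ (-β) * (1 - (d : ℝ) * m / D)
    with hG_def
  set M₁ : ℝ := (D : ℝ) ^ u / (u * (2 - β)) with hM₁_def
  set C : ℝ := ∑ m ∈ Icc 1 D, (m : ℝ) ^ (-β) - (D : ℝ) ^ u / u with hC_def
  -- (1) split the sum into three window sums
  have hsplit : ∑ d ∈ Ioc D₀ D, (χ (d : ZMod D)).re * (d : ℝ) ^ (-β) *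
      (G d - ((D : ℝ) / d) ^ u / (u * (2 - β)) - C) =
      ∑ d ∈ Ioc D₀ D, (χ (d : ZMod D)).re * ((d : ℝ) ^ (-β) * G d)
        - M₁ * ∑ d ∈ Ioc D₀ D, (χ (d : ZMod D)).re * (1 / (d : ℝ))
        - C * ∑ d ∈ Ioc D₀ D, (χ (d : ZMod D)).re * (d : ℝ) ^ (-β) := by
    rw [Finset.mul_sum, Finset.mul_sum, ← Finset.sum_sub_distrib, ← Finset.sum_sub_distrib]
    refine Finset.sum_congr rfl fun d hd => ?_
    have hd1 : (0 : ℝ) < d := by exact_mod_cast (Nat.zero_le D₀).trans_lt (Finset.mem_Ioc.mp hd).1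
    have key := rpow_neg_mul_div_rpow (β := β) hd1 hDpos.le
    rw [← hu_def] at key
    have hu2 : u * (2 - β) ≠ 0 := mul_ne_zero hu0.ne' (by linarith)
    rw [hM₁_def]
    linear_combination (-((χ (d : ZMod D)).re / (u * (2 - β)))) * key
  show |∑ d ∈ Ioc D₀ D, (χ (d : ZMod D)).re * (d : ℝ) ^ (-β) *
      (G d - ((D : ℝ) / d) ^ u / (u * (2 - β)) - C)| ≤ 8 * B / (u * ((D₀ : ℝ) + 1))
  rw [hsplit]
  -- (2) the three Abel bounds
  have hT1 : |∑ d ∈ Ioc D₀ D, (χ (d : ZMod D)).re * ((d : ℝ) ^ (-β) * G d)| ≤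
      2 * B * (((D₀ + 1 : ℕ) : ℝ) ^ (-β) * G (D₀ + 1)) := by
    refine abs_sum_Ioc_re_mul_le_of_bound χ hq hB (a := fun d => (d : ℝ) ^ (-β) * G d)
      (N := D₀) (fun n _ => ?_) (fun n hn => ?_) D
    · exact mul_nonneg (Real.rpow_nonneg (Nat.cast_nonneg n) _) (riesz_inner_nonneg β n)
    · have hn1 : 1 ≤ n := by omega
      have hn0 : (0 : ℝ) < n := by exact_mod_cast hn1
      have hGn0 : 0 ≤ G n := riesz_inner_nonneg β n
      have hmono : G (n + 1) ≤ G n := by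
        simp only [hG_def]
        exact riesz_inner_antitone hn1
      have hpow : ((n + 1 : ℕ) : ℝ) ^ (-β) ≤ (n : ℝ) ^ (-β) := by
        push_cast
        exact Real.rpow_le_rpow_of_nonpos hn0 (by linarith) (by linarith)
      calc ((n + 1 : ℕ) : ℝ) ^ (-β) * G (n + 1) ≤ ((n + 1 : ℕ) : ℝ) ^ (-β) * G n :=
            mul_le_mul_of_nonneg_left hmono (Real.rpow_nonneg (Nat.cast_nonneg _) _)
        _ ≤ (n : ℝ) ^ (-β) * G n := mul_le_mul_of_nonneg_right hpow hGn0
  have hT2 : |∑ d ∈ Ioc D₀ D, (χ (d : ZMod D)).re * (1 / (d : ℝ))| ≤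
      2 * B * (1 / ((D₀ + 1 : ℕ) : ℝ)) := by
    refine abs_sum_Ioc_re_mul_le_of_bound χ hq hB (a := fun d => 1 / (d : ℝ)) (N := D₀)
      (fun n _ => by positivity) (fun n hn => ?_) D
    have hn0 : (0 : ℝ) < n := by exact_mod_cast (Nat.zero_le D₀).trans_lt hn
    push_cast
    exact one_div_le_one_div_of_le hn0 (by linarith)
  have hT3 : |∑ d ∈ Ioc D₀ D, (χ (d : ZMod D)).re * (d : ℝ) ^ (-β)| ≤
      2 * B * ((D₀ + 1 : ℕ) : ℝ) ^ (-β) := by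
    refine abs_sum_Ioc_re_mul_le_of_bound χ hq hB (a := fun d => (d : ℝ) ^ (-β)) (N := D₀)
      (fun n _ => by positivity) (fun n hn => ?_) D
    have hn0 : (0 : ℝ) < n := by exact_mod_cast (Nat.zero_le D₀).trans_lt hn
    push_cast
    exact Real.rpow_le_rpow_of_nonpos hn0 (by linarith) (by linarith)
  -- (3) sizes of the weights at `D₀ + 1`
  have hpow : ((D₀ + 1 : ℕ) : ℝ) ^ (-β) ≤ (7 / 5) / ((D₀ : ℝ) + 1) := by
    push_cast
    exact rpow_neg_le_div hβ1 hDu hD₀1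
  have hGle : G (D₀ + 1) ≤ 1 + (7 / 5) * (1 / (3 * u)) := by
    have hN1 : 1 ≤ D / (D₀ + 1) := (Nat.le_div_iff_mul_le (Nat.succ_pos D₀)).mpr (by simpa using hD₀1)
    have hN : (D / (D₀ + 1) : ℕ) ≤ D := Nat.div_le_self D (D₀ + 1)
    have hNpos : (0 : ℝ) < ((D / (D₀ + 1) : ℕ) : ℝ) := by exact_mod_cast hN1
    have hNu : ((D / (D₀ + 1) : ℕ) : ℝ) ^ u ≤ 7 / 5 :=
      (Real.rpow_le_rpow hNpos.le (by exact_mod_cast hN) hu0.le).trans hDu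
    have hlogN : Real.log ((D / (D₀ + 1) : ℕ) : ℝ) ≤ 1 / (3 * u) :=
      (Real.log_le_log hNpos (by exact_mod_cast hN)).trans hlogD'
    have hlogN0 : 0 ≤ Real.log ((D / (D₀ + 1) : ℕ) : ℝ) := Real.log_nonneg (by exact_mod_cast hN1)
    calc G (D₀ + 1) ≤ ∑ m ∈ Icc 1 (D / (D₀ + 1)), (m : ℝ) ^ (-β) := by
          simp only [hG_def]; exact riesz_inner_le_powerSum β (D₀ + 1)
      _ ≤ 1 + ((D / (D₀ + 1) : ℕ) : ℝ) ^ (1 - β) * Real.log ((D / (D₀ + 1) : ℕ) : ℝ) :=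
          SiegelZero.sum_Icc_rpow_le_log hβ0 hβ1 hN1
      _ ≤ 1 + (7 / 5) * (1 / (3 * u)) := by rw [← hu_def]; gcongr
  have hM₁ : 0 ≤ M₁ ∧ M₁ ≤ (7 / 5) / u := by
    have h2 : 1 ≤ 2 - β := by linarith
    constructor
    · rw [hM₁_def]; positivity
    · rw [hM₁_def, div_le_div_iff₀ (by positivity) hu0]
      have hDu' : (D : ℝ) ^ u ≤ 7 / 5 := hDu
      have : (D : ℝ) ^ u * u ≤ 7 / 5 * u := mul_le_mul_of_nonneg_right hDu' hu0.le
      nlinarith [this, hu0, Real.rpow_nonneg hDpos.le u]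
  have hC : |C| ≤ 1 / u := by
    rw [hC_def, hu_def]; exact SiegelZero.abs_sum_Icc_rpow_sub_le hβ0 hβ1 hD1
  -- (4) combine
  have hGpos : 0 ≤ G (D₀ + 1) := riesz_inner_nonneg β (D₀ + 1)
  have e1 : 2 * B * (((D₀ + 1 : ℕ) : ℝ) ^ (-β) * G (D₀ + 1)) ≤
      2 * B * ((7 / 5) / ((D₀ : ℝ) + 1) * (1 + (7 / 5) * (1 / (3 * u)))) := by
    gcongr
  have e2 : M₁ * |∑ d ∈ Ioc D₀ D, (χ (d : ZMod D)).re * (1 / (d : ℝ))| ≤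
      (7 / 5) / u * (2 * B * (1 / ((D₀ : ℝ) + 1))) := by
    have := hT2
    push_cast at this
    exact mul_le_mul hM₁.2 this (abs_nonneg _) (by positivity)
  have e3 : |C| * |∑ d ∈ Ioc D₀ D, (χ (d : ZMod D)).re * (d : ℝ) ^ (-β)| ≤
      1 / u * (2 * B * ((7 / 5) / ((D₀ : ℝ) + 1))) :=
    mul_le_mul hC (hT3.trans (by gcongr)) (abs_nonneg _) (by positivity)
  have habs : |∑ d ∈ Ioc D₀ D, (χ (d : ZMod D)).re * ((d : ℝ) ^ (-β) * G d)
      - M₁ * ∑ d ∈ Ioc D₀ D, (χ (d : ZMod D)).re * (1 / (d : ℝ))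
      - C * ∑ d ∈ Ioc D₀ D, (χ (d : ZMod D)).re * (d : ℝ) ^ (-β)| ≤
      |∑ d ∈ Ioc D₀ D, (χ (d : ZMod D)).re * ((d : ℝ) ^ (-β) * G d)|
      + M₁ * |∑ d ∈ Ioc D₀ D, (χ (d : ZMod D)).re * (1 / (d : ℝ))|
      + |C| * |∑ d ∈ Ioc D₀ D, (χ (d : ZMod D)).re * (d : ℝ) ^ (-β)| := by
    refine (abs_sub _ _).trans ?_
    refine add_le_add ((abs_sub _ _).trans (add_le_add le_rfl ?_)) ?_
    · rw [abs_mul, abs_of_nonneg hM₁.1]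
    · rw [abs_mul]
  refine habs.trans ?_
  refine (add_le_add (add_le_add (hT1.trans e1) e2) e3).trans ?_
  -- the numerics: `(2B/(D₀+1)) (7/5) (1 + 7/(15u) + 1/u + 1/u) ≤ 8B/(u(D₀+1))` for `u ≤ 1/3`
  have hkey : 2 * B * ((7 / 5) / ((D₀ : ℝ) + 1) * (1 + (7 / 5) * (1 / (3 * u))))
      + (7 / 5) / u * (2 * B * (1 / ((D₀ : ℝ) + 1)))
      + 1 / u * (2 * B * ((7 / 5) / ((D₀ : ℝ) + 1)))
      = B * ((14 / 5) * u + 518 / 75) / (u * ((D₀ : ℝ) + 1)) := by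
    field_simp
    ring
  rw [hkey, div_le_div_iff_of_pos_right (by positivity)]
  have : (14 / 5) * u + 518 / 75 ≤ 8 := by linarith only [hu3]
  nlinarith [this, hB0]


/-- Exponent bookkeeping for `x ≥ 1`: `√x/x ≤ x^{−1/8}`, `x^{7/8}/x = x^{−1/8}`,
`√x/x^{7/8} ≤ x^{−1/8}`. [folklore] -/
private theorem rpow_eighth_facts {x : ℝ} (hx : 1 ≤ x) :
    Real.sqrt x / x ≤ x ^ (-(1 / 8 : ℝ)) ∧ x ^ (7 / 8 : ℝ) / x = x ^ (-(1 / 8 : ℝ)) ∧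
      Real.sqrt x / x ^ (7 / 8 : ℝ) ≤ x ^ (-(1 / 8 : ℝ)) := by
  have hx0 : 0 < x := by linarith
  have hx1 : x = x ^ (1 : ℝ) := (Real.rpow_one x).symm
  refine ⟨?_, ?_, ?_⟩
  · rw [Real.sqrt_eq_rpow]
    conv_lhs => rw [hx1, ← Real.rpow_mul hx0.le, ← Real.rpow_sub hx0]
    exact Real.rpow_le_rpow_of_exponent_le hx (by norm_num)
  · conv_lhs => rw [hx1, ← Real.rpow_mul hx0.le, ← Real.rpow_sub hx0]
    norm_num
  · rw [Real.sqrt_eq_rpow, ← Real.rpow_sub hx0]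
    exact Real.rpow_le_rpow_of_exponent_le hx (by norm_num)

/-- **The asymptotic evaluation of `S(D)`** (the tree's elementary substitute for the contour
shift of print): for `χ` real primitive mod `D ≥ 3`, `2/3 ≤ β < 1` with `L(β, χ) = 0`,
`D^{1−β} ≤ 7/5` and `log D ≤ 1/(3(1−β))` (both automatic under `1 − β ≤ (3 log D)^{−1}`),
`|S(D) − L(1,χ) D^{1−β}/((1−β)(2−β))| ≤ 24 (1 + log D) D^{−1/8}/(1−β)`.
[cite: FriedlanderIwaniec2018Note, §2 (proof of Proposition 2.1)] -/
theorem abs_smoothSum_sub_main_le {D : ℕ} [NeZero D] (hD : 3 ≤ D) (χ : DirichletCharacter ℂ D)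
    (hprim : χ.IsPrimitive) (hq : χ ^ 2 = 1) {β : ℝ} (hβ : 2 / 3 ≤ β) (hβ1 : β < 1)
    (hzero : χ.LFunction β = 0) (hDu : (D : ℝ) ^ (1 - β) ≤ 7 / 5)
    (hlogD : Real.log D ≤ 1 / (3 * (1 - β))) :
    |smoothSum χ β D - (D : ℝ) ^ (1 - β) / ((1 - β) * (2 - β)) * (χ.LFunction 1).re| ≤
      24 * (1 + Real.log D) * (D : ℝ) ^ (-(1 / 8 : ℝ)) / (1 - β) := by
  have hβ0 : (0 : ℝ) < β := by linarith
  have hu0 : 0 < 1 - β := by linarith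
  have hD2 : 2 ≤ D := le_trans (by norm_num) hD
  have hD1 : 1 ≤ D := le_trans (by norm_num) hD
  have hx1 : (1 : ℝ) ≤ D := by exact_mod_cast hD1
  have hx0 : (0 : ℝ) < D := by linarith
  have hlog0 : 0 ≤ Real.log D := Real.log_nonneg hx1
  have hχ1 : χ ≠ 1 := by
    rintro rfl
    rw [DirichletCharacter.isPrimitive_def, DirichletCharacter.conductor_one] at hprim
    omega
  -- Pólya–Vinogradov
  set B : ℝ := Real.sqrt D * (1 + Real.log D) with hB_def
  have hB : ∀ n, ‖partialSum χ n‖ ≤ B := fun n =>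
    DirichletAbel.norm_partialSum_le_polyaVinogradov χ hD2 hprim n
  have hB0 : 0 ≤ B := by rw [hB_def]; positivity
  -- the splitting point `D₀ = ⌊D^{7/8}⌋`
  set D₀ : ℕ := ⌊(D : ℝ) ^ (7 / 8 : ℝ)⌋₊ with hD₀_def
  have hx78 : 0 < (D : ℝ) ^ (7 / 8 : ℝ) := Real.rpow_pos_of_pos hx0 _
  have hD₀le : (D₀ : ℝ) ≤ (D : ℝ) ^ (7 / 8 : ℝ) := Nat.floor_le hx78.le
  have hD₀lt : (D : ℝ) ^ (7 / 8 : ℝ) < (D₀ : ℝ) + 1 := Nat.lt_floor_add_one _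
  have hD₀D : D₀ < D := by
    have h1 : (1 : ℝ) < D := by exact_mod_cast (lt_of_lt_of_le (by norm_num) hD : 1 < D)
    have : (D : ℝ) ^ (7 / 8 : ℝ) < D := by
      conv_rhs => rw [← Real.rpow_one (D : ℝ)]
      exact Real.rpow_lt_rpow_of_exponent_lt h1 (by norm_num)
    exact_mod_cast (hD₀le.trans_lt this)
  -- the decomposition and the split of the error sum
  rw [smoothSum_decomposition χ hβ1]
  have hI : ∀ K : ℕ, Finset.Icc 1 K = Finset.Ioc 0 K := fun K => by
    ext n; simp only [Finset.mem_Icc, Finset.mem_Ioc]; omega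
  have hsplitE : ∑ d ∈ Icc 1 D, (χ (d : ZMod D)).re * (d : ℝ) ^ (-β) *
      (∑ m ∈ Icc 1 (D / d), (m : ℝ) ^ (-β) * (1 - (d : ℝ) * m / D)
        - ((D : ℝ) / d) ^ (1 - β) / ((1 - β) * (2 - β))
        - (∑ m ∈ Icc 1 D, (m : ℝ) ^ (-β) - (D : ℝ) ^ (1 - β) / (1 - β))) =
      ∑ d ∈ Icc 1 D₀, (χ (d : ZMod D)).re * (d : ℝ) ^ (-β) *
        (∑ m ∈ Icc 1 (D / d), (m : ℝ) ^ (-β) * (1 - (d : ℝ) * m / D)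
          - ((D : ℝ) / d) ^ (1 - β) / ((1 - β) * (2 - β))
          - (∑ m ∈ Icc 1 D, (m : ℝ) ^ (-β) - (D : ℝ) ^ (1 - β) / (1 - β)))
      + ∑ d ∈ Ioc D₀ D, (χ (d : ZMod D)).re * (d : ℝ) ^ (-β) *
        (∑ m ∈ Icc 1 (D / d), (m : ℝ) ^ (-β) * (1 - (d : ℝ) * m / D)
          - ((D : ℝ) / d) ^ (1 - β) / ((1 - β) * (2 - β))
          - (∑ m ∈ Icc 1 D, (m : ℝ) ^ (-β) - (D : ℝ) ^ (1 - β) / (1 - β))) := by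
    rw [hI D, hI D₀, ← Finset.sum_Ioc_consecutive _ (Nat.zero_le D₀) hD₀D.le]
  rw [hsplitE]
  -- the four bounds
  have hElong := abs_longRange_le χ hβ hβ1 hDu hlogD hD₀D.le
  have hEshort := abs_shortRange_le χ hq hB hβ hβ1 hDu hlogD hD₀D
  have hT1 : |∑ d ∈ Icc 1 D, (χ (d : ZMod D)).re / d - (χ.LFunction 1).re| ≤ 2 * B / D := by
    refine (abs_sum_Icc_re_div_sub_LFunction_one_le_of_bound χ hχ1 hq hB D).trans ?_
    exact div_le_div_of_nonneg_left (by positivity) hx0 (by linarith)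
  have hTβ : |∑ d ∈ Icc 1 D, (χ (d : ZMod D)).re * (d : ℝ) ^ (-β)| ≤ 2 * B * ((7 / 5) / D) := by
    have hzero' : χ.LFunction (β : ℂ) = 0 := hzero
    refine (abs_sum_Icc_re_mul_rpow_le_of_LFunction_eq_zero_of_bound χ hχ1 hq hB hβ0 hzero'
      D).trans ?_
    refine mul_le_mul_of_nonneg_left ?_ (by positivity)
    have hDD : (D : ℝ) ≤ ((D + 1 : ℕ) : ℝ) := by push_cast; linarith
    calc ((D + 1 : ℕ) : ℝ) ^ (-β) ≤ (D : ℝ) ^ (-β) :=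
          Real.rpow_le_rpow_of_nonpos hx0 hDD (by linarith)
      _ = (D : ℝ) ^ (1 - β) / D := by
          rw [show (1 - β) = -β + 1 by ring, Real.rpow_add hx0, Real.rpow_one]
          field_simp
      _ ≤ (7 / 5) / D := div_le_div_of_nonneg_right hDu hx0.le
  have hM₁ : 0 ≤ (D : ℝ) ^ (1 - β) / ((1 - β) * (2 - β)) ∧
      (D : ℝ) ^ (1 - β) / ((1 - β) * (2 - β)) ≤ (7 / 5) / (1 - β) := by
    have h2 : 1 ≤ 2 - β := by linarith
    constructor
    · positivity
    · rw [div_le_div_iff₀ (by positivity) hu0]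
      have : (D : ℝ) ^ (1 - β) * (1 - β) ≤ 7 / 5 * (1 - β) :=
        mul_le_mul_of_nonneg_right hDu hu0.le
      nlinarith [this, hu0, Real.rpow_nonneg hx0.le (1 - β)]
  have hC : |∑ m ∈ Icc 1 D, (m : ℝ) ^ (-β) - (D : ℝ) ^ (1 - β) / (1 - β)| ≤ 1 / (1 - β) :=
    SiegelZero.abs_sum_Icc_rpow_sub_le hβ0.le hβ1 hD1
  -- triangle inequality
  have habs : ∀ (M L T C U E₁ E₂ : ℝ),
      |M * T + C * U + (E₁ + E₂) - M * L| ≤ |M| * |T - L| + |C| * |U| + |E₁| + |E₂| := by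
    intro M L T C U E₁ E₂
    have e : M * T + C * U + (E₁ + E₂) - M * L = M * (T - L) + C * U + E₁ + E₂ := by ring
    rw [e]
    refine (abs_add_le _ _).trans (add_le_add ((abs_add_le _ _).trans (add_le_add
      ((abs_add_le _ _).trans (add_le_add (le_of_eq (abs_mul _ _)) (le_of_eq (abs_mul _ _))))
      le_rfl)) le_rfl)
  refine (habs _ _ _ _ _ _ _).trans ?_
  rw [abs_of_nonneg hM₁.1]
  -- each term against `T := (1 + log D) D^{-1/8} / (1 - β)`
  obtain ⟨r1, r2, r3⟩ := rpow_eighth_facts hx1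
  set T : ℝ := (1 + Real.log D) * (D : ℝ) ^ (-(1 / 8 : ℝ)) / (1 - β) with hT_def
  have hxe : 0 < (D : ℝ) ^ (-(1 / 8 : ℝ)) := Real.rpow_pos_of_pos hx0 _
  have hBD : B / D ≤ (1 + Real.log D) * (D : ℝ) ^ (-(1 / 8 : ℝ)) := by
    rw [hB_def, mul_comm, mul_div_assoc]
    exact mul_le_mul_of_nonneg_left r1 (by positivity)
  have hD₀D' : (D₀ : ℝ) / D ≤ (1 + Real.log D) * (D : ℝ) ^ (-(1 / 8 : ℝ)) := by
    calc (D₀ : ℝ) / D ≤ (D : ℝ) ^ (7 / 8 : ℝ) / D := div_le_div_of_nonneg_right hD₀le hx0.le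
      _ = (D : ℝ) ^ (-(1 / 8 : ℝ)) := r2
      _ = 1 * (D : ℝ) ^ (-(1 / 8 : ℝ)) := (one_mul _).symm
      _ ≤ (1 + Real.log D) * (D : ℝ) ^ (-(1 / 8 : ℝ)) := by gcongr; linarith
  have hBD₀ : B / ((D₀ : ℝ) + 1) ≤ (1 + Real.log D) * (D : ℝ) ^ (-(1 / 8 : ℝ)) := by
    calc B / ((D₀ : ℝ) + 1) ≤ B / (D : ℝ) ^ (7 / 8 : ℝ) :=
          div_le_div_of_nonneg_left hB0 hx78 hD₀lt.le
      _ = (1 + Real.log D) * (Real.sqrt D / (D : ℝ) ^ (7 / 8 : ℝ)) := by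
          rw [hB_def]; ring
      _ ≤ (1 + Real.log D) * (D : ℝ) ^ (-(1 / 8 : ℝ)) :=
          mul_le_mul_of_nonneg_left r3 (by positivity)
  have b1 : (D : ℝ) ^ (1 - β) / ((1 - β) * (2 - β)) *
      |∑ d ∈ Icc 1 D, (χ (d : ZMod D)).re / d - (χ.LFunction 1).re| ≤ (14 / 5) * T := by
    calc _ ≤ (7 / 5) / (1 - β) * (2 * B / D) := mul_le_mul hM₁.2 hT1 (abs_nonneg _) (by positivity)
      _ = (14 / 5) * ((B / D) / (1 - β)) := by ring
      _ ≤ (14 / 5) * ((1 + Real.log D) * (D : ℝ) ^ (-(1 / 8 : ℝ)) / (1 - β)) := by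
          gcongr
  have b2 : |∑ m ∈ Icc 1 D, (m : ℝ) ^ (-β) - (D : ℝ) ^ (1 - β) / (1 - β)| *
      |∑ d ∈ Icc 1 D, (χ (d : ZMod D)).re * (d : ℝ) ^ (-β)| ≤ (14 / 5) * T := by
    calc _ ≤ 1 / (1 - β) * (2 * B * ((7 / 5) / D)) := mul_le_mul hC hTβ (abs_nonneg _) (by positivity)
      _ = (14 / 5) * ((B / D) / (1 - β)) := by ring
      _ ≤ (14 / 5) * ((1 + Real.log D) * (D : ℝ) ^ (-(1 / 8 : ℝ)) / (1 - β)) := by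
          gcongr
  have b3 : (49 : ℝ) / 5 * D₀ / ((1 - β) * D) ≤ (49 / 5) * T := by
    calc (49 : ℝ) / 5 * D₀ / ((1 - β) * D) = (49 / 5) * (((D₀ : ℝ) / D) / (1 - β)) := by
          field_simp
      _ ≤ (49 / 5) * ((1 + Real.log D) * (D : ℝ) ^ (-(1 / 8 : ℝ)) / (1 - β)) := by
          gcongr
  have b4 : 8 * B / ((1 - β) * ((D₀ : ℝ) + 1)) ≤ 8 * T := by
    have hD₀pos : (0 : ℝ) < (D₀ : ℝ) + 1 := by positivity
    calc 8 * B / ((1 - β) * ((D₀ : ℝ) + 1)) = 8 * ((B / ((D₀ : ℝ) + 1)) / (1 - β)) := by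
          field_simp
      _ ≤ 8 * ((1 + Real.log D) * (D : ℝ) ^ (-(1 / 8 : ℝ)) / (1 - β)) := by
          gcongr
  have hT24 : (14 / 5) * T + (14 / 5) * T + (49 / 5) * T + 8 * T ≤ 24 * T := by
    have hT0 : 0 ≤ T := by rw [hT_def]; positivity
    nlinarith [hT0]
  calc _ ≤ (14 / 5) * T + (14 / 5) * T + (49 / 5) * T + 8 * T :=
        add_le_add (add_le_add (add_le_add b1 b2) (hElong.trans b3)) (hEshort.trans b4)
    _ ≤ 24 * T := hT24
    _ = 24 * (1 + Real.log D) * (D : ℝ) ^ (-(1 / 8 : ℝ)) / (1 - β) := by rw [hT_def]; ring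

end FI2018

/-! ### §5. Proposition 2.1 -/

open FI2018 in
/-- **Friedlander–Iwaniec 2018, Proposition 2.1 holds** (with `c₁ = 1/2`, `c₂ = 8/3`): there is
`D₀` such that for every real primitive `χ` of conductor `D ≥ D₀` and every real zero `β` of
`L(s, χ)` with `1 − β ≤ (3 log D)^{−1}`,
`(1/2)(1 − β) S(D) ≤ L(1, χ) ≤ (8/3)(1 − β) S(D)`.
Proof: `FI2018.abs_smoothSum_sub_main_le` (elementary hyperbola/Abel evaluation with
Pólya–Vinogradov tails) gives `S(D) = M₁ L(1,χ) + O((1 + log D) D^{−1/8}/(1−β))`,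
`M₁ = D^{1−β}/((1−β)(2−β)) ∈ [3/(4(1−β)), (7/5)/(1−β)]`, and Siegel's theorem with `ε = 1/16`
(`Siegel.siegel_theorem_primitive`) makes the error at most `(3/8) L(1,χ)/(1−β)` for
`D ≥ D₀ = max(3, ⌈(2112/c(1/16))^{32}⌉)` — an INEFFECTIVE `D₀` (declared deviation from the
printed contour-integration proof, which is silent on this step).
[cite: FriedlanderIwaniec2018Note, §2 Proposition 2.1 (2.2)]
[cite: MontgomeryVaughan2007, §11.2 Thm. 11.14] -/
theorem fi2018_proposition21_holds : fi2018_proposition21 := by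
  obtain ⟨c, hc, hSiegel⟩ := Siegel.siegel_theorem_primitive (ε := 1 / 16) (by norm_num)
  refine ⟨1 / 2, 8 / 3, by norm_num, by norm_num, max 3 ⌈(2112 / c) ^ 32⌉₊, ?_⟩
  intro D _ hD χ β hβz
  have hD3 : 3 ≤ D := le_trans (le_max_left _ _) hD
  have hDK : (2112 / c) ^ 32 ≤ (D : ℝ) := Nat.ceil_le.mp (le_trans (le_max_right _ _) hD)
  have hx1 : (1 : ℝ) ≤ D := by exact_mod_cast le_trans (by norm_num) hD3
  have hx0 : (0 : ℝ) < D := by linarith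
  -- the standing data
  have hprim := hβz.isPrimitive
  have hq : χ ^ 2 = 1 := MulChar.isQuadratic_iff_sq_eq_one.mp hβz.isQuadratic
  have hβ1 := hβz.lt_one
  obtain ⟨hβ, hlogD, hDu⟩ := close_zero_facts hD3 hβ1 hβz.close
  have hu0 : 0 < 1 - β := by linarith
  have hχ1 : χ ≠ 1 := by
    rintro rfl
    rw [DirichletCharacter.isPrimitive_def, DirichletCharacter.conductor_one] at hprim
    omega
  -- `L = L(1, χ) > 0` is real
  set L : ℝ := (χ.LFunction 1).re with hL_def
  have hLc : c * (D : ℝ) ^ (-(1 / 16 : ℝ)) ≤ L := hSiegel D χ hq hprim hχ1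
  have hLpos : 0 < L := lt_of_lt_of_le (by positivity) hLc
  have hnorm : ‖χ.LFunction 1‖ = L := by
    have e : χ.LFunction 1 = ((L : ℝ) : ℂ) := by
      have := DirichletAbel.LFunction_ofReal_eq_re χ hχ1 hq one_pos
      rwa [Complex.ofReal_one] at this
    rw [e, Complex.norm_real, Real.norm_of_nonneg hLpos.le]
  rw [hnorm]
  -- the asymptotic evaluation
  set S : ℝ := smoothSum χ β D with hS_def
  set M₁ : ℝ := (D : ℝ) ^ (1 - β) / ((1 - β) * (2 - β)) with hM₁_def
  have hmain : |S - M₁ * L| ≤ 24 * (1 + Real.log D) * (D : ℝ) ^ (-(1 / 8 : ℝ)) / (1 - β) :=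
    abs_smoothSum_sub_main_le hD3 χ hprim hq hβ hβ1 hβz.zero hDu hlogD
  -- Siegel: the error is at most `(3/8) L/(1 − β)`
  have hsmall : 24 * (1 + Real.log D) * (D : ℝ) ^ (-(1 / 8 : ℝ)) ≤ (3 / 8) * L := by
    have hK : 0 < 2112 / c := by positivity
    have ht : 2112 / c ≤ (D : ℝ) ^ ((1 : ℝ) / 32) := by
      have e : ((2112 / c) ^ 32 : ℝ) ^ ((1 : ℝ) / 32) = 2112 / c := by
        rw [show ((1 : ℝ) / 32) = ((32 : ℕ) : ℝ)⁻¹ by norm_num]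
        exact Real.pow_rpow_inv_natCast hK.le (by norm_num)
      rw [← e]
      exact Real.rpow_le_rpow (by positivity) hDK (by norm_num)
    have hinv : (D : ℝ) ^ (-((1 : ℝ) / 32)) ≤ c / 2112 := by
      rw [Real.rpow_neg hx0.le]
      calc ((D : ℝ) ^ ((1 : ℝ) / 32))⁻¹ ≤ (2112 / c)⁻¹ := inv_anti₀ hK ht
        _ = c / 2112 := by rw [inv_div]
    have hlog : Real.log D ≤ 32 * (D : ℝ) ^ ((1 : ℝ) / 32) := by
      have := Real.log_le_rpow_div hx0.le (by norm_num : (0 : ℝ) < 1 / 32)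
      linarith
    have hone : 1 ≤ (D : ℝ) ^ ((1 : ℝ) / 32) := Real.one_le_rpow hx1 (by norm_num)
    have h33 : 1 + Real.log D ≤ 33 * (D : ℝ) ^ ((1 : ℝ) / 32) := by linarith
    have hexp : (D : ℝ) ^ ((1 : ℝ) / 32) * (D : ℝ) ^ (-(1 / 8 : ℝ)) =
        (D : ℝ) ^ (-(1 / 16 : ℝ)) * (D : ℝ) ^ (-((1 : ℝ) / 32)) := by
      rw [← Real.rpow_add hx0, ← Real.rpow_add hx0]; norm_num
    have hx8 : 0 ≤ (D : ℝ) ^ (-(1 / 8 : ℝ)) := Real.rpow_nonneg hx0.le _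
    have hx16 : 0 ≤ (D : ℝ) ^ (-(1 / 16 : ℝ)) := Real.rpow_nonneg hx0.le _
    calc 24 * (1 + Real.log D) * (D : ℝ) ^ (-(1 / 8 : ℝ))
        ≤ 24 * (33 * (D : ℝ) ^ ((1 : ℝ) / 32)) * (D : ℝ) ^ (-(1 / 8 : ℝ)) := by gcongr
      _ = 792 * ((D : ℝ) ^ ((1 : ℝ) / 32) * (D : ℝ) ^ (-(1 / 8 : ℝ))) := by ring
      _ = 792 * ((D : ℝ) ^ (-(1 / 16 : ℝ)) * (D : ℝ) ^ (-((1 : ℝ) / 32))) := by rw [hexp]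
      _ ≤ 792 * ((D : ℝ) ^ (-(1 / 16 : ℝ)) * (c / 2112)) := by gcongr
      _ = (3 / 8) * (c * (D : ℝ) ^ (-(1 / 16 : ℝ))) := by ring
      _ ≤ (3 / 8) * L := by gcongr
  have herr : |S - M₁ * L| ≤ (3 / 8) * L / (1 - β) :=
    hmain.trans (div_le_div_of_nonneg_right hsmall hu0.le)
  -- `M₁ (1 − β) = D^{1−β}/(2 − β) ∈ [3/4, 7/5]`
  have hM₁u : M₁ * (1 - β) = (D : ℝ) ^ (1 - β) / (2 - β) := by
    rw [hM₁_def]; field_simp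
  have hDu1 : 1 ≤ (D : ℝ) ^ (1 - β) := Real.one_le_rpow hx1 hu0.le
  have h2β : 1 ≤ 2 - β ∧ 2 - β ≤ 4 / 3 := ⟨by linarith, by linarith⟩
  have hlow : 3 / 4 ≤ M₁ * (1 - β) := by
    rw [hM₁u, le_div_iff₀ (by linarith)]; nlinarith
  have hupp : M₁ * (1 - β) ≤ 7 / 5 := by
    rw [hM₁u, div_le_iff₀ (by linarith)]; nlinarith
  -- conclude
  obtain ⟨herr1, herr2⟩ := abs_le.mp herr
  have hSu1 : (1 - β) * S ≤ (7 / 5) * L + (3 / 8) * L := by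
    have : (1 - β) * S ≤ (1 - β) * (M₁ * L + (3 / 8) * L / (1 - β)) :=
      mul_le_mul_of_nonneg_left (by linarith) hu0.le
    have e : (1 - β) * (M₁ * L + (3 / 8) * L / (1 - β)) = M₁ * (1 - β) * L + (3 / 8) * L := by
      field_simp
    rw [e] at this
    nlinarith [hupp, hLpos]
  have hSu2 : (3 / 4) * L - (3 / 8) * L ≤ (1 - β) * S := by
    have : (1 - β) * (M₁ * L - (3 / 8) * L / (1 - β)) ≤ (1 - β) * S :=
      mul_le_mul_of_nonneg_left (by linarith) hu0.le
    have e : (1 - β) * (M₁ * L - (3 / 8) * L / (1 - β)) = M₁ * (1 - β) * L - (3 / 8) * L := by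
      field_simp
    rw [e] at this
    nlinarith [hlow, hLpos]
  constructor
  · linarith
  · linarith


/-! ### §6. The Deuring–Heilbronn step (3.7): `S(D) ≪ (log η)^{−1} (log D)²` — PROVED

PRINT (p0004): "`S(D) ≪ Σ_{n ≤ D} λ(n)/n ≪ ∏_{p ≤ D}(1 + λ(p)/p)` (3.1). We split this product into
`∏_{p ≤ B}(1 + λ(p)/p) ≤ ∏_{p ≤ B}(1 + 2/p) ≍ (log B)²` (3.2) and
`∏_{B < p ≤ D}(1 + λ(p)/p) ≤ exp(T(D)/log B)` (3.3), `T(D) = Σ_{p ≤ D} λ(p) log p/p` (3.4) …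
[Heath-Brown 1983, Lemma 3:] `T(D) ≪ (log η)^{−1/2} log D` (3.6). Choosing
`log B = (log η)^{−1/2} log D` we obtain `S(D) ≪ (log η)^{−1}(log D)²` (3.7)."

HERE: the same split at `log B = (log η)^{−1/2} log D`, with (3.1) in the exact form
`Σ_{n ≤ D} λ(n)/n ≤ ∏_{p ≤ D} (1 − 1/p)^{−1}(1 − χ(p)/p)^{−1}` (the tree's
`SmoothEulerProduct.sum_le_smoothProduct`), (3.2) from the tree's Mertens bound
`∏_{p ≤ N}(1 − 1/p) ≥ e^{−5}/log N` (`MertensBound.exp_neg_div_log_le_prod_one_sub_inv`), and — the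
declared deviation — the range `B < p ≤ D` controlled not through Heath-Brown's `T(D)` but through
Tao–Teräväinen's Corollary 3.6 (first bound), a THEOREM of the tree
(`SiegelZero.TaoTeravainen2021_cor36_i_of_prop35` with `TaoTeravainen2021_eq313_holds`,
`TaoTeravainen2021_eq314_holds`): `Σ_{D^{1/√log η} ≤ p* ≤ D} 1/p* ≪ e^{−√(log η)/2}` over the
exceptional primes `p*` (`χ(p*) ≠ −1`), for `η ≥ η₀`; non-exceptional primes contribute the
convergent `∏ (1 − 1/p²)^{−1}`. For `3 ≤ η < η₀` the bound is trivial (`S(D) ≪ (log D)²`). -/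

namespace FI2018

/-- `λ(n) = r(n) = Re (1 ∗ χ)(n)` (the tree's two spellings of the divisor sum of a real character).
[folklore] -/
private theorem charDivisorSum_eq_zetaMul_re {D : ℕ} (χ : DirichletCharacter ℂ D) (n : ℕ) :
    RealChar.charDivisorSum χ n = (χ.zetaMul n).re := by
  rw [RealChar.charDivisorSum_apply, SiegelZero.re_zetaMul_apply]
  refine Finset.sum_congr rfl fun d hd => ?_
  rw [DirichletAbel.reChar_apply χ (Nat.pos_of_mem_divisors hd).ne']

/-- **`S(D) ≤ D^{1−β} Σ_{n ≤ D} λ(n)/n`** (`0 ≤ 1 − n/D ≤ 1`, `n^{−β} = n^{1−β}/n ≤ D^{1−β}/n`,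
`λ ≥ 0`). [cite: FriedlanderIwaniec2018Note, §3 (3.1)] -/
theorem smoothSum_le_rpow_mul_harmonicSum {D : ℕ} [NeZero D] (χ : DirichletCharacter ℂ D)
    (hq : χ ^ 2 = 1) {β : ℝ} (hβ1 : β < 1) :
    smoothSum χ β D ≤ (D : ℝ) ^ (1 - β) * ∑ n ∈ Icc 1 D, (χ.zetaMul n).re / n := by
  unfold smoothSum
  rw [Nat.floor_natCast, Finset.mul_sum]
  refine Finset.sum_le_sum fun n hn => ?_
  have hn1 : 1 ≤ n := (Finset.mem_Icc.mp hn).1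
  have hnD : n ≤ D := (Finset.mem_Icc.mp hn).2
  have hn0 : (0 : ℝ) < n := by exact_mod_cast hn1
  have hD0 : (0 : ℝ) < D := by exact_mod_cast hn1.trans hnD
  have hr : 0 ≤ RealChar.charDivisorSum χ n := RealChar.charDivisorSum_nonneg χ hq n
  rw [charDivisorSum_eq_zetaMul_re] at hr ⊢
  have hw0 : 0 ≤ 1 - (n : ℝ) / D := by
    rw [sub_nonneg, div_le_one hD0]; exact_mod_cast hnD
  have hw1 : 1 - (n : ℝ) / D ≤ 1 := by
    have : 0 ≤ (n : ℝ) / D := by positivity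
    linarith
  have hpow : (n : ℝ) ^ (-β) ≤ (D : ℝ) ^ (1 - β) / n := by
    rw [show -β = (1 - β) + (-1) by ring, Real.rpow_add hn0, Real.rpow_neg_one, ← div_eq_mul_inv]
    exact div_le_div_of_nonneg_right (Real.rpow_le_rpow hn0.le (by exact_mod_cast hnD) (by linarith))
      hn0.le
  calc (χ.zetaMul n).re * (1 - (n : ℝ) / D) * (n : ℝ) ^ (-β)
      ≤ (χ.zetaMul n).re * 1 * ((D : ℝ) ^ (1 - β) / n) := by
        gcongr
    _ = (D : ℝ) ^ (1 - β) * ((χ.zetaMul n).re / n) := by ring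

/-- Each Euler factor of `ζ(s)L(s,χ)` at `1` is at most the square of the `ζ`-factor:
`(1 − 1/p)^{−1}(1 − χ(p)/p)^{−1} ≤ (1 − 1/p)^{−2}` (`|χ(p)| ≤ 1`, `p ≥ 2`).
[cite: FriedlanderIwaniec2018Note, §3 (3.2)] -/
private theorem eulerFactor_le_sq {D : ℕ} (χ : DirichletCharacter ℂ D) {p : ℕ} (hp : p.Prime) :
    (1 - (p : ℝ)⁻¹)⁻¹ * (1 - (χ p).re * (p : ℝ)⁻¹)⁻¹ ≤ ((1 - (p : ℝ)⁻¹)⁻¹) ^ 2 := by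
  have hp2 : (2 : ℝ) ≤ p := by exact_mod_cast hp.two_le
  have hpinv : (p : ℝ)⁻¹ ≤ 1 / 2 := by rw [inv_eq_one_div]; exact one_div_le_one_div_of_le two_pos hp2
  have hpinv0 : 0 < (p : ℝ)⁻¹ := by positivity
  have hc : |(χ p).re| ≤ 1 := (Complex.abs_re_le_norm _).trans (χ.norm_le_one _)
  have h1 : 0 < 1 - (p : ℝ)⁻¹ := by linarith
  have hcle : 1 - (p : ℝ)⁻¹ ≤ 1 - (χ p).re * (p : ℝ)⁻¹ := by
    have : (χ p).re * (p : ℝ)⁻¹ ≤ 1 * (p : ℝ)⁻¹ :=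
      mul_le_mul_of_nonneg_right (abs_le.mp hc).2 hpinv0.le
    linarith
  have h2 : 0 < 1 - (χ p).re * (p : ℝ)⁻¹ := lt_of_lt_of_le h1 hcle
  rw [sq]
  exact mul_le_mul_of_nonneg_left (inv_anti₀ h1 hcle) (inv_nonneg.mpr h1.le)

/-- **(3.2) in the tree's form**: `∏_{p ≤ N} (1 − 1/p)^{−1}(1 − χ(p)/p)^{−1} ≤ (e⁵ log N)²` for
`N ≥ 2` (each factor `≤ (1 − 1/p)^{−2}` and Mertens' `∏_{p ≤ N}(1 − 1/p) ≥ e^{−5}/log N`).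
[cite: FriedlanderIwaniec2018Note, §3 (3.2)] -/
theorem prod_eulerFactor_le_log_sq {D : ℕ} (χ : DirichletCharacter ℂ D) {N : ℕ} (hN : 2 ≤ N) :
    ∏ p ∈ Nat.primesLE N, (1 - (p : ℝ)⁻¹)⁻¹ * (1 - (χ p).re * (p : ℝ)⁻¹)⁻¹ ≤
      (Real.exp 5 * Real.log N) ^ 2 := by
  have hN' : (2 : ℝ) ≤ N := by exact_mod_cast hN
  have hlogN : 0 < Real.log N := Real.log_pos (by linarith)
  have hM := MertensBound.exp_neg_div_log_le_prod_one_sub_inv N hN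
  simp only [one_div] at hM
  have hP0 : 0 < ∏ p ∈ Nat.primesLE N, (1 - (p : ℝ)⁻¹) := lt_of_lt_of_le (by positivity) hM
  have hPinv : (∏ p ∈ Nat.primesLE N, (1 - (p : ℝ)⁻¹))⁻¹ ≤ Real.exp 5 * Real.log N := by
    have h := inv_anti₀ (by positivity : 0 < Real.exp (-5) / Real.log N) hM
    refine h.trans (le_of_eq ?_)
    rw [inv_div, Real.exp_neg]; field_simp
  calc ∏ p ∈ Nat.primesLE N, (1 - (p : ℝ)⁻¹)⁻¹ * (1 - (χ p).re * (p : ℝ)⁻¹)⁻¹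
      ≤ ∏ p ∈ Nat.primesLE N, ((1 - (p : ℝ)⁻¹)⁻¹) ^ 2 := by
        refine Finset.prod_le_prod (fun p hp => ?_) (fun p hp => ?_)
        · have hp := (Nat.mem_primesLE.mp hp).2
          have hp2 : (2 : ℝ) ≤ p := by exact_mod_cast hp.two_le
          have h1 : 0 < 1 - (p : ℝ)⁻¹ := by
            have : (p : ℝ)⁻¹ ≤ 1 / 2 := by
              rw [inv_eq_one_div]; exact one_div_le_one_div_of_le two_pos hp2
            linarith
          have hc : |(χ p).re| ≤ 1 := (Complex.abs_re_le_norm _).trans (χ.norm_le_one _)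
          have h2 : 0 < 1 - (χ p).re * (p : ℝ)⁻¹ := by
            have : (χ p).re * (p : ℝ)⁻¹ ≤ 1 * (p : ℝ)⁻¹ :=
              mul_le_mul_of_nonneg_right (abs_le.mp hc).2 (by positivity)
            linarith
          positivity
        · exact eulerFactor_le_sq χ (Nat.mem_primesLE.mp hp).2
    _ = (∏ p ∈ Nat.primesLE N, (1 - (p : ℝ)⁻¹))⁻¹ ^ 2 := by
        rw [Finset.prod_pow, Finset.prod_inv_distrib]
    _ ≤ (Real.exp 5 * Real.log N) ^ 2 := by
        gcongr

/-- Each Euler factor beyond `B`: `(1 − 1/p)^{−1}(1 − χ(p)/p)^{−1} ≤ exp(4/p² + 8 · 𝟙[χ(p) ≠ −1]/p)`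
(for `χ(p) = −1` the factor is `(1 − 1/p²)^{−1}`; otherwise it is `≤ (1 − 1/p)^{−2}`).
[cite: FriedlanderIwaniec2018Note, §3 (3.3)] -/
private theorem eulerFactor_le_exp {D : ℕ} (χ : DirichletCharacter ℂ D) (hq : χ ^ 2 = 1) {p : ℕ}
    (hp : p.Prime) :
    (1 - (p : ℝ)⁻¹)⁻¹ * (1 - (χ p).re * (p : ℝ)⁻¹)⁻¹ ≤
      Real.exp (4 * ((p : ℝ)⁻¹) ^ 2 +
        8 * (if χ (p : ZMod D) ≠ -1 then (p : ℝ)⁻¹ else 0)) := by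
  have hp2 : (2 : ℝ) ≤ p := by exact_mod_cast hp.two_le
  have hp0 : (0 : ℝ) < p := by linarith
  have hpinv : (p : ℝ)⁻¹ ≤ 1 / 2 := by rw [inv_eq_one_div]; exact one_div_le_one_div_of_le two_pos hp2
  have hpinv0 : 0 ≤ (p : ℝ)⁻¹ := by positivity
  -- `(1 − 1/p)^{−1} ≤ exp(4/p)` and `(1 − 1/p²)^{−1} ≤ exp(4/p²)` (the tree's Rankin-factor lemma)
  have hA : (1 - (p : ℝ)⁻¹)⁻¹ ≤ Real.exp (4 * (p : ℝ)⁻¹) := by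
    have := SmoothEulerProduct.inv_one_sub_le_exp_mul (a := 0) (v := (p : ℝ)⁻¹) hpinv0 (by linarith)
    simpa using this
  have hB : (1 - ((p : ℝ)⁻¹) ^ 2)⁻¹ ≤ Real.exp (4 * ((p : ℝ)⁻¹) ^ 2) := by
    have hv : ((p : ℝ)⁻¹) ^ 2 ≤ 3 / 4 := by nlinarith
    have := SmoothEulerProduct.inv_one_sub_le_exp_mul (a := 0) (v := ((p : ℝ)⁻¹) ^ 2)
      (sq_nonneg _) hv
    simpa using this
  rcases SmoothEulerProduct.apply_re_trichotomy χ hq p with h | h | h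
  · -- `χ(p) = 0`
    have hne : χ (p : ZMod D) ≠ -1 := by
      intro h'; rw [h'] at h; norm_num at h
    rw [if_pos hne, h, zero_mul, sub_zero, inv_one, mul_one]
    refine hA.trans (Real.exp_le_exp.mpr ?_)
    nlinarith [sq_nonneg ((p : ℝ)⁻¹)]
  · -- `χ(p) = 1`
    have hne : χ (p : ZMod D) ≠ -1 := by
      intro h'; rw [h'] at h; norm_num at h
    rw [if_pos hne, h, one_mul]
    have h1 : 0 ≤ (1 - (p : ℝ)⁻¹)⁻¹ := inv_nonneg.mpr (by linarith)
    calc (1 - (p : ℝ)⁻¹)⁻¹ * (1 - (p : ℝ)⁻¹)⁻¹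
        ≤ Real.exp (4 * (p : ℝ)⁻¹) * Real.exp (4 * (p : ℝ)⁻¹) :=
          mul_le_mul hA hA h1 (Real.exp_pos _).le
      _ = Real.exp (8 * (p : ℝ)⁻¹) := by rw [← Real.exp_add]; ring_nf
      _ ≤ _ := Real.exp_le_exp.mpr (by nlinarith [sq_nonneg ((p : ℝ)⁻¹)])
  · -- `χ(p) = −1`: the factor is `(1 − 1/p²)^{−1}`
    have heq : χ (p : ZMod D) = -1 := by
      rw [SmoothEulerProduct.apply_eq_re χ hq p, h]; norm_num
    rw [if_neg (not_not.mpr heq), h, mul_zero, add_zero]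
    have e : (1 - (p : ℝ)⁻¹)⁻¹ * (1 - (-1) * (p : ℝ)⁻¹)⁻¹ = (1 - ((p : ℝ)⁻¹) ^ 2)⁻¹ := by
      rw [← mul_inv]; congr 1; ring
    rw [e]
    exact hB

/-- `Σ_{p ∈ s} 1/p² ≤ 1` for a set of primes `s` (indeed `Σ_{n ≥ 2} 1/n² < 1`). [folklore] -/
private theorem sum_inv_sq_primes_le_one (s : Finset ℕ) (hs : ∀ p ∈ s, p.Prime) :
    ∑ p ∈ s, ((p : ℝ)⁻¹) ^ 2 ≤ 1 := by
  -- compare with the telescoping `Σ_{2 ≤ n ≤ N} 1/(n(n−1)) = 1 − 1/N`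
  obtain ⟨N, hN⟩ : ∃ N, ∀ p ∈ s, p ≤ N := ⟨s.sup id, fun p hp => Finset.le_sup (f := id) hp⟩
  have hsub : s ⊆ Finset.Icc 2 N := fun p hp =>
    Finset.mem_Icc.mpr ⟨(hs p hp).two_le, hN p hp⟩
  have htel : ∀ M : ℕ, ∑ n ∈ Finset.Icc 2 M, ((n : ℝ)⁻¹) ^ 2 ≤ 1 - (M : ℝ)⁻¹ ∨ M < 2 := by
    intro M
    induction M with
    | zero => right; omega
    | succ M ih =>
      rcases Nat.lt_or_ge (M + 1) 2 with hM | hM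
      · right; exact hM
      left
      rcases ih with ih | ih
      · rw [Finset.sum_Icc_succ_top (by omega), ]
        have hM0 : (1 : ℝ) ≤ M := by
          have : 1 ≤ M := by omega
          exact_mod_cast this
        have hM1 : (0 : ℝ) < (M : ℝ) + 1 := by linarith
        push_cast
        have key : (((M : ℝ) + 1)⁻¹) ^ 2 ≤ (M : ℝ)⁻¹ - ((M : ℝ) + 1)⁻¹ := by
          rw [show (M : ℝ)⁻¹ - ((M : ℝ) + 1)⁻¹ = ((M : ℝ) * (M + 1))⁻¹ by field_simp; ring]
          rw [inv_pow]
          apply inv_anti₀ (by positivity)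
          nlinarith
        linarith
      · -- `M < 2`, so `M + 1 = 2`
        have hM2 : M + 1 = 2 := by omega
        rw [hM2]
        norm_num
  rcases htel N with h | h
  · calc ∑ p ∈ s, ((p : ℝ)⁻¹) ^ 2 ≤ ∑ n ∈ Finset.Icc 2 N, ((n : ℝ)⁻¹) ^ 2 :=
          Finset.sum_le_sum_of_subset_of_nonneg hsub fun n _ _ => by positivity
      _ ≤ 1 - (N : ℝ)⁻¹ := h
      _ ≤ 1 := by linarith [inv_nonneg.mpr (Nat.cast_nonneg N : (0 : ℝ) ≤ N)]
  · have : s = ∅ := by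
      rw [Finset.eq_empty_iff_forall_notMem]
      intro p hp
      have := (hs p hp).two_le
      have := hN p hp
      omega
    rw [this, Finset.sum_empty]; norm_num

/-- Under the standing data, `β = 1 − 1/(η log D)` with `η = eta D β`, and `η ≥ 3`, `log η ≥ 1`.
[cite: FriedlanderIwaniec2018Note, §3 (3.5)] -/
theorem eta_facts {D : ℕ} [NeZero D] {χ : DirichletCharacter ℂ D} {β : ℝ}
    (h : IsCloseRealZero χ β) :
    1 - 1 / (eta D β * Real.log D) = β ∧ 3 ≤ eta D β ∧ 1 ≤ Real.log (eta D β) := by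
  have hD' : (3 : ℝ) ≤ D := by exact_mod_cast h.three_le
  have hlog1 : 1 ≤ Real.log D := by
    rw [Real.le_log_iff_exp_le (by linarith)]
    exact (Real.exp_one_lt_d9.le.trans (by norm_num)).trans hD'
  have hlog0 : 0 < Real.log D := by linarith
  have hu0 : 0 < 1 - β := by linarith [h.lt_one]
  have h3 := h.three_le_eta
  refine ⟨?_, h3, ?_⟩
  · unfold eta
    field_simp
    ring
  · rw [Real.le_log_iff_exp_le (by linarith)]
    exact (Real.exp_one_lt_d9.le.trans (by norm_num)).trans h3

end FI2018

open FI2018 in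
/-- **Friedlander–Iwaniec 2018, (3.7) holds**: there are `C > 0` and `D₀` such that for every real
primitive `χ` of conductor `D ≥ D₀` and every real zero `β` of `L(s,χ)` with
`1 − β ≤ (3 log D)^{−1}`, `S(D) ≤ C (log D)²/log η`, `η = 1/((1 − β) log D)`.
Proof (see the §6 docstring): `S(D) ≤ D^{1−β} Σ_{n≤D} λ(n)/n ≤ (7/5) ∏_{p ≤ D}(1−1/p)^{−1}(1−χ(p)/p)^{−1}`;
the primes `p ≤ B = D^{1/√log η}` give `≤ (e⁵ log B)² = e^{10} (log D)²/log η`; the primes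
`B < p ≤ D` give `≤ exp(4 + 8K)` by Tao–Teräväinen's Corollary 3.6 (a theorem of the tree), once
`η ≥ η₀`; for `3 ≤ η < η₀`, `S(D) ≤ (7/5) e^{10} (log D)² ≤ (7/5) e^{10} log η₀ · (log D)²/log η`.
The constants are ineffective (Siegel, through Tao–Teräväinen). Declared deviation from print:
Heath-Brown's Lemma 3 ((3.6), the bound for `T(D)`) is replaced by Tao–Teräväinen's Corollary 3.6.
[cite: FriedlanderIwaniec2018Note, §3 (3.1)–(3.7)]
[cite: TaoTeravainen2021, Corollary 3.6 (first bound)] -/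
theorem fi2018_eq37_holds : fi2018_eq37 := by
  -- Tao–Teräväinen Corollary 3.6 (first bound) with `ε = 1`, and `η ≤ D` for large `η`
  obtain ⟨K, η₁, Hc⟩ := SiegelZero.TaoTeravainen2021_cor36_i_of_prop35
    SiegelZero.TaoTeravainen2021_eq313_holds SiegelZero.TaoTeravainen2021_eq314_holds 1 one_pos
  obtain ⟨η₂, Hη⟩ := SiegelZero.exists_eta_le_rpow (ε := 1) one_pos
  set K' : ℝ := max K 0 with hK'
  set η₀ : ℝ := max (max η₁ η₂) 3 with hη₀
  have hη₀3 : 3 ≤ η₀ := le_max_right _ _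
  have hlogη₀ : 1 ≤ Real.log η₀ := by
    rw [Real.le_log_iff_exp_le (by linarith)]
    exact (Real.exp_one_lt_d9.le.trans (by norm_num)).trans hη₀3
  -- the constant
  set C : ℝ := 7 / 5 * (Real.exp 10 * Real.exp (4 + 8 * K') + Real.exp 10 * Real.log η₀) with hC
  refine ⟨C, by positivity, 3, ?_⟩
  intro D _ hD χ β hβz
  have hD' : (3 : ℝ) ≤ D := by exact_mod_cast hD
  have hD1 : (1 : ℝ) ≤ D := by linarith
  have hD0 : (0 : ℝ) < D := by linarith
  have hprim := hβz.isPrimitive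
  have hq : χ ^ 2 = 1 := MulChar.isQuadratic_iff_sq_eq_one.mp hβz.isQuadratic
  have hβ1 := hβz.lt_one
  obtain ⟨hβ, hlogD, hDu⟩ := close_zero_facts hD hβ1 hβz.close
  have hβ0 : (0 : ℝ) < β := by linarith
  have hχ1 : χ ≠ 1 := by
    rintro rfl
    rw [DirichletCharacter.isPrimitive_def, DirichletCharacter.conductor_one] at hprim
    omega
  obtain ⟨hβη, hη3, hlogη1⟩ := eta_facts hβz
  set η : ℝ := eta D β with hη_def
  have hη0 : 0 < η := by linarith
  have hlogη0 : 0 < Real.log η := by linarith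
  have hlogD1 : 1 ≤ Real.log D := by
    rw [Real.le_log_iff_exp_le hD0]
    exact (Real.exp_one_lt_d9.le.trans (by norm_num)).trans hD'
  have hlogD0 : 0 < Real.log D := by linarith
  -- the zero in Tao–Teräväinen's form
  have hzeroTT : χ.LFunction ((1 - 1 / (η * Real.log D) : ℝ) : ℂ) = 0 := by
    rw [hβη]; exact hβz.zero
  -- Step 1: `S(D) ≤ (7/5) Π_{p ≤ D} F_p`
  have hS1 := smoothSum_le_rpow_mul_harmonicSum χ hq hβ1
  have hS2 : ∑ n ∈ Icc 1 D, (χ.zetaMul n).re / n ≤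
      ∏ p ∈ Nat.primesLE D, (1 - (p : ℝ)⁻¹)⁻¹ * (1 - (χ p).re * (p : ℝ)⁻¹)⁻¹ :=
    SmoothEulerProduct.sum_le_smoothProduct χ hq (Nat.lt_succ_self D)
  have hsum0 : 0 ≤ ∑ n ∈ Icc 1 D, (χ.zetaMul n).re / n :=
    Finset.sum_nonneg fun n _ => div_nonneg (SmoothEulerProduct.zetaMul_re_nonneg χ hq n)
      (Nat.cast_nonneg n)
  set PE : ℝ := ∏ p ∈ Nat.primesLE D, (1 - (p : ℝ)⁻¹)⁻¹ * (1 - (χ p).re * (p : ℝ)⁻¹)⁻¹ with hPE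
  have hSPE : smoothSum χ β D ≤ 7 / 5 * PE :=
    hS1.trans (mul_le_mul hDu hS2 hsum0 (by norm_num))
  -- the factors are positive
  have hFpos : ∀ p ∈ Nat.primesLE D, 0 < (1 - (p : ℝ)⁻¹)⁻¹ * (1 - (χ p).re * (p : ℝ)⁻¹)⁻¹ := by
    intro p hp
    have hp := (Nat.mem_primesLE.mp hp).2
    have hp2 : (2 : ℝ) ≤ p := by exact_mod_cast hp.two_le
    have h1 : 0 < 1 - (p : ℝ)⁻¹ := by
      have : (p : ℝ)⁻¹ ≤ 1 / 2 := by
        rw [inv_eq_one_div]; exact one_div_le_one_div_of_le two_pos hp2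
      linarith
    have hc : |(χ p).re| ≤ 1 := (Complex.abs_re_le_norm _).trans (χ.norm_le_one _)
    have h2 : 0 < 1 - (χ p).re * (p : ℝ)⁻¹ := by
      have : (χ p).re * (p : ℝ)⁻¹ ≤ 1 * (p : ℝ)⁻¹ :=
        mul_le_mul_of_nonneg_right (abs_le.mp hc).2 (by positivity)
      linarith
    positivity
  -- Step 2: the trivial bound `Π ≤ (e⁵ log D)² ≤ e^{10} (log D)²`
  have hPEtriv : PE ≤ Real.exp 10 * Real.log D ^ 2 := by
    refine (prod_eulerFactor_le_log_sq χ (le_trans (by norm_num) hD)).trans (le_of_eq ?_)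
    rw [mul_pow, ← Real.exp_nat_mul]; norm_num
  -- Case split on `η ≥ η₀`
  rcases lt_or_ge η η₀ with hsmall | hlarge
  · -- `η < η₀`: `S(D) ≤ (7/5) e^{10} (log D)² ≤ C (log D)²/log η`
    have hlogηle : Real.log η ≤ Real.log η₀ := Real.log_le_log hη0 hsmall.le
    calc smoothSum χ β D ≤ 7 / 5 * PE := hSPE
      _ ≤ 7 / 5 * (Real.exp 10 * Real.log D ^ 2) := by gcongr
      _ = 7 / 5 * (Real.exp 10 * Real.log η) * (Real.log D ^ 2 / Real.log η) := by
          field_simp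
      _ ≤ C * (Real.log D ^ 2 / Real.log η) := by
          apply mul_le_mul_of_nonneg_right _ (div_nonneg (sq_nonneg _) hlogη0.le)
          rw [hC]
          have : Real.exp 10 * Real.log η ≤
              Real.exp 10 * Real.exp (4 + 8 * K') + Real.exp 10 * Real.log η₀ := by
            have h1 : Real.exp 10 * Real.log η ≤ Real.exp 10 * Real.log η₀ := by gcongr
            have h2 : 0 ≤ Real.exp 10 * Real.exp (4 + 8 * K') := by positivity
            linarith
          linarith
      _ = C * Real.log D ^ 2 / Real.log η := by ring
  · -- `η ≥ η₀`: split the product at `B = D^{1/√log η}`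
    have hη1 : η₁ ≤ η := le_trans (le_trans (le_max_left _ _) (le_max_left _ _)) hlarge
    have hη2 : η₂ ≤ η := le_trans (le_trans (le_max_right _ _) (le_max_left _ _)) hlarge
    have hηD : η ≤ D := by
      have := Hη D χ hχ1 hq η hη2 hzeroTT
      rwa [Real.rpow_one] at this
    set b : ℝ := Real.sqrt (Real.log η) with hb_def
    have hb1 : 1 ≤ b := by rw [hb_def]; exact Real.one_le_sqrt.mpr hlogη1
    have hb0 : 0 < b := by linarith
    have hbsq : b ^ 2 = Real.log η := by rw [hb_def]; exact Real.sq_sqrt hlogη0.le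
    have hblog : b ≤ Real.sqrt (Real.log D) := by
      rw [hb_def]; exact Real.sqrt_le_sqrt (Real.log_le_log hη0 hηD)
    set B : ℝ := (D : ℝ) ^ (1 / b) with hB_def
    have hB0 : 0 < B := Real.rpow_pos_of_pos hD0 _
    have hlogB : Real.log B = Real.log D / b := by
      rw [hB_def, Real.log_rpow hD0]; ring
    -- `log B ≥ √(log D) ≥ 1`, so `B ≥ e > 2`
    have hlogB1 : 1 ≤ Real.log B := by
      rw [hlogB, le_div_iff₀ hb0]
      have hs : Real.sqrt (Real.log D) * Real.sqrt (Real.log D) = Real.log D :=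
        Real.mul_self_sqrt hlogD0.le
      have hs1 : 1 ≤ Real.sqrt (Real.log D) := Real.one_le_sqrt.mpr hlogD1
      nlinarith
    have hB2 : (2 : ℝ) ≤ B := by
      have h1 : Real.exp 1 ≤ B := by
        rw [← Real.log_le_log_iff (Real.exp_pos 1) hB0, Real.log_exp]
        exact hlogB1
      exact le_trans (by linarith [Real.add_one_le_exp (1 : ℝ)]) h1
    have hBD : B ≤ D := by
      have : (D : ℝ) ^ (1 / b) ≤ (D : ℝ) ^ (1 : ℝ) :=
        Real.rpow_le_rpow_of_exponent_le hD1 (by rw [div_le_one hb0]; exact hb1)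
      rwa [Real.rpow_one] at this
    set N₀ : ℕ := ⌊B⌋₊ with hN₀_def
    have hN₀2 : 2 ≤ N₀ := Nat.le_floor (by exact_mod_cast hB2)
    have hN₀B : (N₀ : ℝ) ≤ B := Nat.floor_le hB0.le
    have hBN₀ : B < (N₀ : ℝ) + 1 := Nat.lt_floor_add_one B
    have hN₀D : N₀ ≤ D := by exact_mod_cast hN₀B.trans hBD
    have hN₀pos : (0 : ℝ) < N₀ := by exact_mod_cast lt_of_lt_of_le (by norm_num) hN₀2
    -- split the product
    have hsplit : PE = (∏ p ∈ (Nat.primesLE D).filter (fun p => p ≤ N₀),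
        (1 - (p : ℝ)⁻¹)⁻¹ * (1 - (χ p).re * (p : ℝ)⁻¹)⁻¹) *
        ∏ p ∈ (Nat.primesLE D).filter (fun p => ¬ p ≤ N₀),
          (1 - (p : ℝ)⁻¹)⁻¹ * (1 - (χ p).re * (p : ℝ)⁻¹)⁻¹ := by
      rw [hPE, Finset.prod_filter_mul_prod_filter_not]
    have hsmallset : (Nat.primesLE D).filter (fun p => p ≤ N₀) = Nat.primesLE N₀ := by
      ext p
      simp only [Finset.mem_filter, Nat.mem_primesLE]
      constructor
      · rintro ⟨⟨-, hp⟩, hpN⟩; exact ⟨hpN, hp⟩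
      · rintro ⟨hpN, hp⟩; exact ⟨⟨hpN.trans hN₀D, hp⟩, hpN⟩
    -- small primes: `≤ (e⁵ log N₀)² ≤ e^{10} (log D)²/log η`
    have hsmall : ∏ p ∈ (Nat.primesLE D).filter (fun p => p ≤ N₀),
        (1 - (p : ℝ)⁻¹)⁻¹ * (1 - (χ p).re * (p : ℝ)⁻¹)⁻¹ ≤
        Real.exp 10 * (Real.log D ^ 2 / Real.log η) := by
      rw [hsmallset]
      refine (prod_eulerFactor_le_log_sq χ hN₀2).trans ?_
      have hlogN₀ : Real.log N₀ ≤ Real.log D / b := by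
        rw [← hlogB]; exact Real.log_le_log hN₀pos hN₀B
      have hlogN₀0 : 0 ≤ Real.log N₀ := Real.log_nonneg (by exact_mod_cast le_trans (by norm_num) hN₀2)
      calc (Real.exp 5 * Real.log N₀) ^ 2 ≤ (Real.exp 5 * (Real.log D / b)) ^ 2 := by gcongr
        _ = Real.exp 10 * (Real.log D ^ 2 / Real.log η) := by
            rw [mul_pow, ← Real.exp_nat_mul, div_pow, hbsq]; norm_num
    -- large primes: each factor `≤ exp(4/p² + 8·𝟙[p exceptional]/p)`
    set S : Finset ℕ := (Nat.primesLE D).filter (fun p => ¬ p ≤ N₀) with hS_def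
    have hSprime : ∀ p ∈ S, p.Prime := fun p hp =>
      (Nat.mem_primesLE.mp (Finset.mem_filter.mp hp).1).2
    have hlarge1 : ∏ p ∈ S, (1 - (p : ℝ)⁻¹)⁻¹ * (1 - (χ p).re * (p : ℝ)⁻¹)⁻¹ ≤
        Real.exp (∑ p ∈ S, (4 * ((p : ℝ)⁻¹) ^ 2 +
          8 * (if χ (p : ZMod D) ≠ -1 then (p : ℝ)⁻¹ else 0))) := by
      rw [Real.exp_sum]
      refine Finset.prod_le_prod (fun p hp => (hFpos p (Finset.mem_filter.mp hp).1).le)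
        (fun p hp => eulerFactor_le_exp χ hq (hSprime p hp))
    have hsq : ∑ p ∈ S, 4 * ((p : ℝ)⁻¹) ^ 2 ≤ 4 := by
      rw [← Finset.mul_sum]
      have := sum_inv_sq_primes_le_one S hSprime
      linarith
    -- the exceptional primes beyond `B`: Tao–Teräväinen Corollary 3.6
    have hexc : ∑ p ∈ S, (if χ (p : ZMod D) ≠ -1 then (p : ℝ)⁻¹ else 0) ≤ K' := by
      rw [← Finset.sum_filter]
      have hsub : S.filter (fun p : ℕ => χ (p : ZMod D) ≠ -1) ⊆
          SiegelZero.excPrimes χ (Icc ⌈((D : ℝ)) ^ (1 / Real.sqrt (Real.log η))⌉₊ ⌊(D : ℝ)⌋₊) := by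
        intro p hp
        rw [Finset.mem_filter] at hp
        obtain ⟨hpS, hpχ⟩ := hp
        have hpD := (Nat.mem_primesLE.mp (Finset.mem_filter.mp hpS).1)
        have hpN : ¬ p ≤ N₀ := (Finset.mem_filter.mp hpS).2
        rw [SiegelZero.mem_excPrimes, Finset.mem_Icc, Nat.floor_natCast]
        refine ⟨⟨?_, hpD.1⟩, hpD.2, hpχ⟩
        rw [← hb_def, ← hB_def]
        refine Nat.ceil_le.mpr ?_
        have : (N₀ : ℝ) + 1 ≤ p := by exact_mod_cast (show N₀ + 1 ≤ p by omega)
        linarith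
      have hx1 : ((D : ℕ) : ℝ) ^ ((1 + 1) / 2 : ℝ) ≤ (D : ℝ) := by norm_num
      have hx2 : (D : ℝ) ≤ ((D : ℕ) : ℝ) ^ Real.sqrt η := by
        have h1 : (1 : ℝ) ≤ Real.sqrt η := Real.one_le_sqrt.mpr (by linarith)
        have := Real.rpow_le_rpow_of_exponent_le hD1 h1
        rwa [Real.rpow_one] at this
      have hTT := Hc D χ hprim hβz.isQuadratic η hη1 hzeroTT (D : ℝ) hx1 hx2
      have hexp1 : Real.exp (-Real.sqrt (Real.log η) / 2) ≤ 1 := by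
        rw [Real.exp_le_one_iff]
        have := Real.sqrt_nonneg (Real.log η)
        linarith
      calc ∑ p ∈ S.filter (fun p : ℕ => χ (p : ZMod D) ≠ -1), (p : ℝ)⁻¹
          ≤ ∑ p ∈ SiegelZero.excPrimes χ
              (Icc ⌈((D : ℝ)) ^ (1 / Real.sqrt (Real.log η))⌉₊ ⌊(D : ℝ)⌋₊), (1 : ℝ) / p := by
            refine (Finset.sum_le_sum_of_subset_of_nonneg hsub fun p _ _ => by positivity).trans ?_
            exact le_of_eq (Finset.sum_congr rfl fun p _ => (one_div _).symm)
        _ ≤ K * Real.exp (-Real.sqrt (Real.log η) / 2) := hTT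
        _ ≤ K' * Real.exp (-Real.sqrt (Real.log η) / 2) :=
            mul_le_mul_of_nonneg_right (le_max_left _ _) (Real.exp_pos _).le
        _ ≤ K' * 1 := mul_le_mul_of_nonneg_left hexp1 (le_max_right _ _)
        _ = K' := mul_one _
    have hlarge : ∏ p ∈ S, (1 - (p : ℝ)⁻¹)⁻¹ * (1 - (χ p).re * (p : ℝ)⁻¹)⁻¹ ≤
        Real.exp (4 + 8 * K') := by
      refine hlarge1.trans (Real.exp_le_exp.mpr ?_)
      rw [Finset.sum_add_distrib]
      have h8 : ∑ p ∈ S, 8 * (if χ (p : ZMod D) ≠ -1 then (p : ℝ)⁻¹ else 0) =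
          8 * ∑ p ∈ S, (if χ (p : ZMod D) ≠ -1 then (p : ℝ)⁻¹ else 0) := by
        rw [Finset.mul_sum]
      rw [h8]
      linarith [hsq, hexc]
    -- assemble
    have hsmall0 : 0 ≤ ∏ p ∈ (Nat.primesLE D).filter (fun p => p ≤ N₀),
        (1 - (p : ℝ)⁻¹)⁻¹ * (1 - (χ p).re * (p : ℝ)⁻¹)⁻¹ :=
      Finset.prod_nonneg fun p hp => (hFpos p (Finset.mem_filter.mp hp).1).le
    have hPEle : PE ≤ Real.exp 10 * (Real.log D ^ 2 / Real.log η) * Real.exp (4 + 8 * K') := by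
      rw [hsplit]
      have hpos1 : 0 ≤ Real.exp 10 * (Real.log D ^ 2 / Real.log η) :=
        mul_nonneg (Real.exp_pos _).le (div_nonneg (sq_nonneg _) hlogη0.le)
      exact mul_le_mul hsmall hlarge (Finset.prod_nonneg fun p hp =>
        (hFpos p (Finset.mem_filter.mp hp).1).le) hpos1
    calc smoothSum χ β D ≤ 7 / 5 * PE := hSPE
      _ ≤ 7 / 5 * (Real.exp 10 * (Real.log D ^ 2 / Real.log η) * Real.exp (4 + 8 * K')) := by
          gcongr
      _ = 7 / 5 * (Real.exp 10 * Real.exp (4 + 8 * K')) * (Real.log D ^ 2 / Real.log η) := by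
          ring
      _ ≤ C * (Real.log D ^ 2 / Real.log η) := by
          apply mul_le_mul_of_nonneg_right _ (div_nonneg (sq_nonneg _) hlogη0.le)
          rw [hC]
          have : 0 ≤ Real.exp 10 * Real.log η₀ := by positivity
          linarith [this]
      _ = C * Real.log D ^ 2 / Real.log η := by ring


/-! ### §7. The unconditional consequences: (4.1) and Theorem 2 of the note -/

/-- **Friedlander–Iwaniec 2018, (4.1), UNCONDITIONAL**: there are `C > 0` and `D₀` such that for
every real primitive `χ` of conductor `D ≥ D₀` and every real zero `β` of `L(s, χ)` with
`1 − β ≤ (3 log D)^{−1}`: `L(1, χ) ≤ C (1 − β)(log D)²/log η`, `η = 1/((1 − β) log D)`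
(the statement file's `FI2018.eq41_of` fed with `fi2018_proposition21_holds` and `fi2018_eq37_holds`;
constants ineffective). [cite: FriedlanderIwaniec2018Note, §4 (4.1)] -/
theorem FI2018.eq41 :
    ∃ C : ℝ, 0 < C ∧ ∃ D₀ : ℕ, ∀ (D : ℕ) [NeZero D], D₀ ≤ D →
      ∀ (χ : DirichletCharacter ℂ D) (β : ℝ), FI2018.IsCloseRealZero χ β →
        ‖χ.LFunction 1‖ ≤ C * ((1 - β) * Real.log D ^ 2 / Real.log (FI2018.eta D β)) :=
  FI2018.eq41_of fi2018_proposition21_holds fi2018_eq37_holds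

/-- **Friedlander–Iwaniec 2018, Theorem 2, UNCONDITIONAL** ("If `L(s, χ)` has a real zero `β` with
`1 − β ≪ (log D)^{−3} log log D` (1.7), then `L(1, χ) ≪ (log D)^{−1}` (1.6) holds"): for every
`A > 0` there are `C > 0` and `D₀` such that for `D ≥ D₀` (`D ≥ 3`), a real primitive `χ` of
conductor `D` and a real zero `β < 1` of `L(s, χ)` with `1 − β ≤ A (log D)^{−3} log log D`,
`L(1, χ) ≤ C/log D` (the statement file's `FI2018.theorem2_of` fed with the two discharges;
constants ineffective). [cite: FriedlanderIwaniec2018Note, §1 Theorem 2 (with §4)] -/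
theorem FI2018.theorem2 :
    ∀ A : ℝ, 0 < A → ∃ C : ℝ, 0 < C ∧ ∃ D₀ : ℕ, ∀ (D : ℕ) [NeZero D], D₀ ≤ D → 3 ≤ D →
      ∀ (χ : DirichletCharacter ℂ D) (β : ℝ), χ.IsPrimitive → χ.IsQuadratic →
        χ.LFunction (β : ℂ) = 0 → β < 1 →
        1 - β ≤ A * Real.log (Real.log D) / Real.log D ^ 3 →
        ‖χ.LFunction 1‖ ≤ C / Real.log D :=
  FI2018.theorem2_of fi2018_proposition21_holds fi2018_eq37_holds

end Literature.NumberTheory.LFunctions
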